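import Literature.Analysis.FluidPDE.TaoCarlemanFirstIneq
import HarnessLib

/-!
# Palasek 2021, Prop 9 (backward-uniqueness Carleman estimate in cylindrical shells), I:
# the cylindrical square, the cylindrical weight and the cut-off of a truncated shell

Analysis/FluidPDE support file (theorems only, no definitions, no named facts), first half of the
proof of **Prop 9** of S. Palasek, *Improved quantitative regularity for the Navier–Stokes equations
in a scale of critical spaces*, Arch. Ration. Mech. Anal. 242 (2021) 1479–1531 (arXiv:2101.08586),
§4 — the backward-uniqueness Carleman inequality in truncated cylindrical shells
`{r₋ ≤ r ≤ r₊, |z| ≤ r₊}` (`r` the distance to an axis, `z` the axial coordinate; Palasek's case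
`d₁ = 2`, `d₂ = 1`), which replaces Tao's annular Prop. 4.2 (`TaoCarlemanFirst*.lean`) in the proof
of Palasek's main estimate (Prop 11) and hence of
`Literature.Analysis.FluidPDE.palasek2021_axisym_quantitative_ess` (Thm 1, `q = 3`, axisymmetric).
The second half (cut-off field, core inequality, assembly) is `PalasekCylindricalCarleman.lean`.

Palasek, §4 (proof of Prop 9): "With the weight `g(x,t) = r₊(T₀−t)/(2C₀T²) · r + |x|²/(C₀T)`, we
apply the general Carleman inequality to `ψu`, where `ψ` is a smooth spatial cutoff supported in
`{r₋ ≤ r ≤ r₊, |z| ≤ r₊}` that equals `1` in `{2r₋ ≤ r ≤ r₊/2, |z| ≤ r₊/2}` and obeys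
`|∇ʲψ(x)| ≲ r₋^{-j}` for `j = 0, 1, 2`. Since the function `r` is convex, we have
`D²g ≥ (2/(C₀T)) Id` as quadratic forms. With `F = ∂ₜg − Δg − |∇g|²`, we compute
`F = −(r₊/(2C₀T²)) r − (r₊(T₀−t)/(2C₀T²))(d₁−1)/r − 2(d₁+d₂)/(C₀T) − r₊²(T₀−t)²/(4C₀²T⁴) −
4|x|²/(C₀²T²) − 2r₊(T₀−t)r/(C₀²T³) ≤ 0`. It follows that `LF = r₊²(T₀−t)/(2C₀²T⁴) + 2r₊r/(C₀²T³) −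
(r₊(T₀−t)/(2C₀T²))(d₁−1)(3−d₁)/r³ − 8(d₁+d₂)/(C₀²T²) − 2r₊(T₀−t)(d₁−1)/(C₀²T³r)`."

The file follows the tree's `TaoCarlemanFirstWeight.lean` step by step, in an abstract
finite-dimensional real inner product space `E` with a unit vector `a` (the axis) and the
**cylindrical square** `m(x) = |x|² − ⟪x,a⟫² = r²`:

* calculus of `m` and of `⟪x,a⟫²` in the frame operators of `CarlemanCalculus.lean`
  (`∂ₑm = 2(⟪x,e⟫ − ⟪x,a⟫⟪e,a⟫)`, `|∇m|² = 4m`, `Δm = 2(d−1)`, `|∇⟪x,a⟫²|² = 4⟪x,a⟫²`,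
  `Δ⟪x,a⟫² = 2`), cylindrical profiles `χ(m)`, products `τ(t)χ(m)`, axial profiles `η(⟪x,a⟫²)`;
* the weight `g = α(T₀−t)P(m) + b|x|²` (`P` the regularised radius of
  `TaoCarlemanFirstWeight.exists_regularised_radius`, `α = br₊/(2T)`, `b = (C₀T)⁻¹`): global formulas
  for `∂ₜg, ∂ₑg, ∂ₑ'∂ₑg, Δg, |∇g|²`, their values on the region `m > ρ²/4` for general `d` (Palasek's
  `F` with `d₁ = d − 1`, `d₂ = 1`), the smooth global form `Φ` of `F`, `LF = ∂ₜΦ + ΔΦ` on the region,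
  **the convexity of the distance to the axis** `2D²g(X,X) ≥ 4bΣ|Xᵢ|²` (`t ≤ T₀`) through the
  Bessel-type inequality `norm_sq_sum_smul_add_le`, and the specialised Carleman rate inequality
  `cyl_carleman_rate` (Lemma 4.1 of Tao = Palasek's Lemma 2, `TaoCarlemanLemma.lean`);
* the cut-off of the truncated shell: `exists_axial_cutoff` (plateau `⟪x,a⟫² ≤ r₊²/4`, support
  `⟪x,a⟫² ≤ (9/25)r₊²`), `exists_cylRadial_cutoff` (Tao's annular profile in the variable `m`),
  and their product `exists_cyl_cutoff` with `|∇ψ|², |Δψ| ≤ C/r₋²`.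

## References

* S. Palasek, arXiv:2101.08586 (Arch. Ration. Mech. Anal. 242, 2021), §4: Lemma 2, Prop 9 and its
  proof. [Palasek2021]
* T. Tao, arXiv:1908.04958v2 (2021), §4, Lemma 4.1 and Prop. 4.2 (the annular model). [Tao2021QuantitativeNS]
-/

noncomputable section

open MeasureTheory Set Function Filter Topology Metric
open scoped InnerProductSpace RealInnerProductSpace Laplacian

namespace Literature.Analysis.FluidPDE

namespace PalasekCarleman

open Carleman TaoCarleman

variable {E : Type*} [NormedAddCommGroup E] [InnerProductSpace ℝ E]
variable {F : Type*} [NormedAddCommGroup F] [InnerProductSpace ℝ F]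

/-! ### The cylindrical square `m(x) = |x|² − ⟪x,a⟫²` -/

section CylSq

variable {a : E} (ha : ‖a‖ = 1) {m : ℝ × E → ℝ} (hm : m = fun y : ℝ × E => ‖y.2‖ ^ 2 - ⟪y.2, a⟫ ^ 2)

include hm in
/-- The cylindrical square is smooth. [folklore] -/
theorem contDiff_cylSq {n : WithTop ℕ∞} : ContDiff ℝ n m := by
  rw [hm]
  exact contDiff_norm_sq_snd.sub ((contDiff_inner_snd_const a).pow 2)

include hm in
/-- **Derivative of the cylindrical square**: `Dm(z)v = 2⟪x, v₂⟫ − 2⟪x,a⟫⟪v₂,a⟫`. [folklore] -/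
theorem fderiv_cylSq_apply (z v : ℝ × E) :
    fderiv ℝ m z v = 2 * ⟪z.2, v.2⟫ - 2 * ⟪z.2, a⟫ * ⟪v.2, a⟫ := by
  rw [hm]
  have hN : DifferentiableAt ℝ (fun y : ℝ × E => ‖y.2‖ ^ 2) z :=
    (contDiff_norm_sq_snd (E := E) (n := 1)).differentiable one_ne_zero z
  have hI : DifferentiableAt ℝ (fun y : ℝ × E => ⟪y.2, a⟫) z :=
    (contDiff_inner_snd_const a (n := 1)).differentiable one_ne_zero z
  have hI2 : DifferentiableAt ℝ (fun y : ℝ × E => ⟪y.2, a⟫ ^ 2) z := hI.pow 2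
  rw [fderiv_fun_sub hN hI2, _root_.sub_apply, fderiv_norm_sq_snd_apply,
    show (fun y : ℝ × E => ⟪y.2, a⟫ ^ 2) = fun y => (fun s : ℝ => s ^ 2) (⟪y.2, a⟫) from rfl,
    fderiv_comp_scalar_apply (differentiableAt_pow 2) hI, fderiv_inner_snd_const]
  simp only [deriv_pow_field, Nat.cast_ofNat]
  ring

include hm in
/-- `∂ₜm = 0`. [folklore] -/
theorem dt_cylSq (z : ℝ × E) : dt m z = 0 := by
  rw [dt_apply, fderiv_cylSq_apply hm]
  simp

include hm in
/-- `∂ₑm = 2(⟪x,e⟫ − ⟪x,a⟫⟪e,a⟫)`. [folklore] -/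
theorem dx_cylSq (e : E) (z : ℝ × E) : dx e m z = 2 * (⟪z.2, e⟫ - ⟪z.2, a⟫ * ⟪e, a⟫) := by
  rw [dx_apply, fderiv_cylSq_apply hm]
  simp only
  ring

include hm in
/-- `∂ₑ'∂ₑm = 2(⟪e',e⟫ − ⟪e',a⟫⟪e,a⟫)`. [folklore] -/
theorem dx_dx_cylSq (e e' : E) (z : ℝ × E) :
    dx e' (dx e m) z = 2 * (⟪e', e⟫ - ⟪e', a⟫ * ⟪e, a⟫) := by
  -- `∂ₑm = ⟪x, 2(e − ⟪e,a⟫a)⟫` is linear in `x`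
  have hfun : dx e m = fun y : ℝ × E => ⟪y.2, (2 : ℝ) • (e - ⟪e, a⟫ • a)⟫ := by
    funext y
    rw [dx_cylSq hm e y, real_inner_smul_right, inner_sub_right, real_inner_smul_right]
    ring
  rw [hfun, dx_apply, fderiv_inner_snd_const]
  simp only
  rw [real_inner_smul_right, inner_sub_right, real_inner_smul_right, real_inner_comm a e]
  ring

include ha hm in
/-- The cylindrical square is the squared distance to the axis:
`m(x) = |x − ⟪x,a⟫a|²` (for a unit vector `a`). [folklore] -/
theorem cylSq_eq_norm_sq_proj (z : ℝ × E) : m z = ‖z.2 - ⟪z.2, a⟫ • a‖ ^ 2 := by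
  rw [hm]
  simp only
  rw [@norm_sub_sq_real, norm_smul, Real.norm_eq_abs, ha, mul_one, sq_abs, real_inner_smul_right]
  ring

include ha hm in
/-- `0 ≤ m`. [folklore] -/
theorem cylSq_nonneg (z : ℝ × E) : 0 ≤ m z := by
  rw [cylSq_eq_norm_sq_proj ha hm]
  positivity

include hm in
/-- `m ≤ |x|²`. [folklore] -/
theorem cylSq_le_norm_sq (z : ℝ × E) : m z ≤ ‖z.2‖ ^ 2 := by
  rw [hm]
  simp only
  nlinarith [sq_nonneg ⟪z.2, a⟫]

include hm in
/-- `m + ⟪x,a⟫² = |x|²`. [folklore] -/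
theorem cylSq_add_inner_sq (z : ℝ × E) : m z + ⟪z.2, a⟫ ^ 2 = ‖z.2‖ ^ 2 := by
  rw [hm]
  simp only
  ring

variable [FiniteDimensional ℝ E]

include ha in
omit [InnerProductSpace ℝ F] in
/-- Frame sum for the projected vector: `Σᵢ (⟪x,eᵢ⟫ − ⟪x,a⟫⟪eᵢ,a⟫)² = |x|² − ⟪x,a⟫²`. [folklore] -/
theorem sum_sq_inner_proj (x : E) :
    ∑ i, (⟪x, stdOrthonormalBasis ℝ E i⟫ - ⟪x, a⟫ * ⟪stdOrthonormalBasis ℝ E i, a⟫) ^ 2 =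
      ‖x‖ ^ 2 - ⟪x, a⟫ ^ 2 := by
  have h1 : ∀ i, ⟪x, stdOrthonormalBasis ℝ E i⟫ - ⟪x, a⟫ * ⟪stdOrthonormalBasis ℝ E i, a⟫ =
      ⟪x - ⟪x, a⟫ • a, stdOrthonormalBasis ℝ E i⟫ := fun i => by
    rw [inner_sub_left, real_inner_smul_left, real_inner_comm (stdOrthonormalBasis ℝ E i) a]
  simp only [h1]
  rw [(stdOrthonormalBasis ℝ E).sum_sq_inner_left, @norm_sub_sq_real, norm_smul, Real.norm_eq_abs,
    ha, mul_one, sq_abs, real_inner_smul_right]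
  ring

include ha in
omit [InnerProductSpace ℝ F] in
/-- Frame sum `Σᵢ (1 − ⟪eᵢ,a⟫²) = d − 1` for a unit vector `a`. [folklore] -/
theorem sum_one_sub_inner_sq :
    ∑ i, (1 - ⟪stdOrthonormalBasis ℝ E i, a⟫ ^ 2) = (Module.finrank ℝ E : ℝ) - 1 := by
  rw [Finset.sum_sub_distrib, Finset.sum_const, Finset.card_univ, Fintype.card_fin, nsmul_eq_mul,
    mul_one]
  congr 1
  have := (stdOrthonormalBasis ℝ E).sum_sq_inner_left a
  rw [ha, one_pow] at this
  rw [← this]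
  exact Finset.sum_congr rfl fun i _ => by rw [real_inner_comm]

include ha hm in
/-- `|∇m|² = 4m`. [folklore] -/
theorem gradSq_cylSq (z : ℝ × E) : gradSq m z = 4 * m z := by
  unfold gradSq
  simp only [dx_cylSq hm, Real.norm_eq_abs, sq_abs, mul_pow]
  rw [← Finset.mul_sum, sum_sq_inner_proj ha, hm]
  norm_num

include ha hm in
/-- `Δm = 2(d − 1)`. [folklore] -/
theorem lap_cylSq (z : ℝ × E) : lap m z = 2 * ((Module.finrank ℝ E : ℝ) - 1) := by
  rw [show lap m z = ∑ i, dx (stdOrthonormalBasis ℝ E i) (dx (stdOrthonormalBasis ℝ E i) m) z from rfl]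
  simp only [dx_dx_cylSq hm, real_inner_self_eq_norm_sq, (stdOrthonormalBasis ℝ E).orthonormal.1, one_pow]
  rw [← Finset.mul_sum, ← sum_one_sub_inner_sq ha]
  congr 1
  exact Finset.sum_congr rfl fun i _ => by ring

end CylSq

/-! ### Cylindrical profiles `χ(m)` and products `τ(t) χ(m)` -/

section Profiles

variable {a : E} (ha : ‖a‖ = 1) {m : ℝ × E → ℝ} (hm : m = fun y : ℝ × E => ‖y.2‖ ^ 2 - ⟪y.2, a⟫ ^ 2)

include hm in
/-- `∂ₜ χ(m) = 0`. [folklore] -/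
theorem dt_cyl {χ : ℝ → ℝ} (hχ : Differentiable ℝ χ) (z : ℝ × E) :
    dt (fun y : ℝ × E => χ (m y)) z = 0 := by
  rw [dt_comp_scalar (hχ _) ((contDiff_cylSq hm (n := 1)).differentiable one_ne_zero _), dt_cylSq hm,
    mul_zero]

include hm in
/-- `∂ₑ χ(m) = 2χ'(m)(⟪x,e⟫ − ⟪x,a⟫⟪e,a⟫)`. [folklore] -/
theorem dx_cyl {χ : ℝ → ℝ} (hχ : Differentiable ℝ χ) (e : E) (z : ℝ × E) :
    dx e (fun y : ℝ × E => χ (m y)) z = 2 * deriv χ (m z) * (⟪z.2, e⟫ - ⟪z.2, a⟫ * ⟪e, a⟫) := by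
  rw [dx_comp_scalar (hχ _) ((contDiff_cylSq hm (n := 1)).differentiable one_ne_zero _), dx_cylSq hm]
  ring

variable [FiniteDimensional ℝ E]

include ha hm in
/-- `|∇χ(m)|² = 4χ'(m)² m`. [folklore] -/
theorem gradSq_cyl {χ : ℝ → ℝ} (hχ : Differentiable ℝ χ) (z : ℝ × E) :
    gradSq (fun y : ℝ × E => χ (m y)) z = 4 * deriv χ (m z) ^ 2 * m z := by
  rw [gradSq_comp_scalar (hχ _) ((contDiff_cylSq hm (n := 1)).differentiable one_ne_zero _),
    gradSq_cylSq ha hm]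
  ring

include ha hm in
/-- `Δχ(m) = 4χ''(m) m + 2(d−1)χ'(m)`. [folklore] -/
theorem lap_cyl {χ : ℝ → ℝ} (hχ : ContDiff ℝ 2 χ) (z : ℝ × E) :
    lap (fun y : ℝ × E => χ (m y)) z =
      4 * deriv (deriv χ) (m z) * m z + 2 * ((Module.finrank ℝ E : ℝ) - 1) * deriv χ (m z) := by
  rw [lap_comp_scalar isOpen_univ (mem_univ z) hχ (contDiff_cylSq hm).contDiffOn, gradSq_cylSq ha hm,
    lap_cylSq ha hm]
  ring

include hm in
omit [FiniteDimensional ℝ E] in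
/-- `∂ₜ(τ(t)χ(m)) = τ'(t)χ(m)`. [folklore] -/
theorem dt_timeCyl {τ χ : ℝ → ℝ} (hτ : ContDiff ℝ 2 τ) (hχ : ContDiff ℝ 2 χ) (z : ℝ × E) :
    dt (fun y : ℝ × E => τ y.1 * χ (m y)) z = deriv τ z.1 * χ (m z) := by
  have hτ1 : ContDiff ℝ 1 τ := hτ.of_le (by norm_num)
  have hχd : Differentiable ℝ χ := hχ.differentiable (by norm_num)
  have hτz : DifferentiableAt ℝ (fun y : ℝ × E => τ y.1) z :=
    ((hτ.differentiable (by norm_num)) _).comp z differentiableAt_fst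
  have hmz : DifferentiableAt ℝ (fun y : ℝ × E => χ (m y)) z :=
    (hχd _).comp z ((contDiff_cylSq hm (n := 1)).differentiable one_ne_zero z)
  rw [dt_mul hτz hmz, dt_cyl hm hχd, dt_timeProfile hτ1]
  ring

include ha hm in
/-- `Δ(τ(t)χ(m)) = τ(t)(4χ''(m) m + 2(d−1)χ'(m))`. [folklore] -/
theorem lap_timeCyl {τ χ : ℝ → ℝ} (hτ : ContDiff ℝ 2 τ) (hχ : ContDiff ℝ 2 χ) (z : ℝ × E) :
    lap (fun y : ℝ × E => τ y.1 * χ (m y)) z =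
      τ z.1 * (4 * deriv (deriv χ) (m z) * m z + 2 * ((Module.finrank ℝ E : ℝ) - 1) * deriv χ (m z)) := by
  have hτ1 : ContDiff ℝ 1 τ := hτ.of_le (by norm_num)
  have hτE : ContDiffOn ℝ 2 (fun y : ℝ × E => τ y.1) univ := (hτ.comp contDiff_fst).contDiffOn
  have hmE : ContDiffOn ℝ 2 (fun y : ℝ × E => χ (m y)) univ := (hχ.comp (contDiff_cylSq hm)).contDiffOn
  rw [lap_mul isOpen_univ (mem_univ z) hτE hmE, lap_cyl ha hm hχ, lap_timeProfile hτ1]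
  simp only [dx_timeProfile hτ1, zero_mul, Finset.sum_const_zero, mul_zero, add_zero]

end Profiles

/-! ### A convexity inequality for coefficient vectors -/

section Convexity

omit [InnerProductSpace ℝ E]

/-- **Bessel-type inequality for two orthogonal coefficient vectors.** For vectors `Xᵢ ∈ F`, a unit
coefficient vector `c` (`Σcᵢ² = 1`) and a coefficient vector `w` orthogonal to it (`Σcᵢwᵢ = 0`):
`‖Σ wᵢXᵢ‖² + (Σwᵢ²) ‖Σ cᵢXᵢ‖² ≤ (Σwᵢ²) Σ‖Xᵢ‖²` — expand `Σᵢ ‖Xᵢ − cᵢA − (wᵢ/Σwⱼ²)W‖² ≥ 0`,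
`A = ΣcᵢXᵢ`, `W = ΣwᵢXᵢ`. This is the convexity of the distance to an axis
(Palasek 2021, §4: "Since the function `r` is convex, we have `D²g ≥ (2/(C₀T))Id`"). [cite: Palasek2021, §4 (proof of Prop 9)] -/
theorem norm_sq_sum_smul_add_le {ι : Type*} [Fintype ι] (c w : ι → ℝ) (X : ι → F)
    (hc : ∑ i, c i ^ 2 = 1) (hcw : ∑ i, c i * w i = 0) :
    ‖∑ i, w i • X i‖ ^ 2 + (∑ i, w i ^ 2) * ‖∑ i, c i • X i‖ ^ 2 ≤ (∑ i, w i ^ 2) * ∑ i, ‖X i‖ ^ 2 := by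
  set A : F := ∑ i, c i • X i with hA
  set W : F := ∑ i, w i • X i with hW
  set S : ℝ := ∑ i, w i ^ 2 with hS
  have hS0 : 0 ≤ S := Finset.sum_nonneg fun i _ => sq_nonneg _
  -- pairings with `A` and `W`
  have hXA : ∑ i, c i * ⟪X i, A⟫ = ‖A‖ ^ 2 := by
    rw [← real_inner_self_eq_norm_sq, hA, sum_inner]
    exact Finset.sum_congr rfl fun i _ => by rw [real_inner_smul_left]
  have hXW : ∑ i, w i * ⟪X i, W⟫ = ‖W‖ ^ 2 := by
    rw [← real_inner_self_eq_norm_sq, hW, sum_inner]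
    exact Finset.sum_congr rfl fun i _ => by rw [real_inner_smul_left]
  have hcXW : ∑ i, c i * ⟪X i, W⟫ = ⟪A, W⟫ := by
    rw [hA, sum_inner]
    exact Finset.sum_congr rfl fun i _ => by rw [real_inner_smul_left]
  rcases eq_or_lt_of_le hS0 with hS00 | hSpos
  · -- `w = 0`
    have hw0 : ∀ i, w i = 0 := fun i => by
      have := (Finset.sum_eq_zero_iff_of_nonneg fun j _ => sq_nonneg (w j)).1 hS00.symm i (Finset.mem_univ i)
      exact pow_eq_zero_iff (n := 2) two_ne_zero |>.1 this
    have hW0 : W = 0 := by rw [hW]; exact Finset.sum_eq_zero fun i _ => by rw [hw0 i, zero_smul]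
    rw [hW0, ← hS00]
    simp
  -- expand `0 ≤ Σ ‖Xᵢ − cᵢA − (wᵢ/S)W‖²`
  have key : 0 ≤ ∑ i, ‖X i - c i • A - (w i / S) • W‖ ^ 2 := Finset.sum_nonneg fun i _ => sq_nonneg _
  have hexp : ∀ i, ‖X i - c i • A - (w i / S) • W‖ ^ 2 =
      ‖X i‖ ^ 2 + c i ^ 2 * ‖A‖ ^ 2 + (w i / S) ^ 2 * ‖W‖ ^ 2 - 2 * (c i * ⟪X i, A⟫) -
        2 * ((w i / S) * ⟪X i, W⟫) + 2 * (c i * (w i / S) * ⟪A, W⟫) := fun i => by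
    rw [← real_inner_self_eq_norm_sq, ← real_inner_self_eq_norm_sq (X i), ← real_inner_self_eq_norm_sq A,
      ← real_inner_self_eq_norm_sq W]
    simp only [inner_sub_left, inner_sub_right, real_inner_smul_left, real_inner_smul_right,
      real_inner_comm A (X i), real_inner_comm W (X i), real_inner_comm W A]
    ring
  simp only [hexp] at key
  rw [Finset.sum_add_distrib, Finset.sum_sub_distrib, Finset.sum_sub_distrib, Finset.sum_add_distrib,
    Finset.sum_add_distrib, ← Finset.sum_mul, ← Finset.sum_mul, ← Finset.mul_sum, ← Finset.mul_sum,
    ← Finset.mul_sum, hc, hXA] at key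
  have h3 : ∑ i, (w i / S) ^ 2 = 1 / S := by
    simp only [div_pow]
    rw [← Finset.sum_div, ← hS]
    field_simp
  have h4 : ∑ i, w i / S * ⟪X i, W⟫ = ‖W‖ ^ 2 / S := by
    simp only [div_mul_eq_mul_div]
    rw [← Finset.sum_div, hXW]
  have h5 : ∑ i, c i * (w i / S) * ⟪A, W⟫ = 0 := by
    simp only [mul_div_assoc', div_mul_eq_mul_div]
    rw [← Finset.sum_div, ← Finset.sum_mul, hcw, zero_mul, zero_div]
  rw [h3, h4, h5] at key
  -- `key : 0 ≤ Σ‖X‖² + ‖A‖² + ‖W‖²/S − 2‖A‖² − 2‖W‖²/S + 0`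
  have hdiv : 1 / S * ‖W‖ ^ 2 = ‖W‖ ^ 2 / S := by ring
  have key' : ‖W‖ ^ 2 / S + ‖A‖ ^ 2 ≤ ∑ i, ‖X i‖ ^ 2 := by linarith [key, hdiv]
  have := mul_le_mul_of_nonneg_left key' hS0
  rwa [mul_add, mul_div_cancel₀ _ hSpos.ne'] at this

end Convexity

/-! ### The cylindrical linear–quadratic weight `g = α(T₀ − t) P(m) + b|x|²` -/

section Weight

variable {a : E} (ha : ‖a‖ = 1) {m : ℝ × E → ℝ} (hm : m = fun y : ℝ × E => ‖y.2‖ ^ 2 - ⟪y.2, a⟫ ^ 2)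
variable {α T₀ b : ℝ} {P : ℝ → ℝ} (hP : ContDiff ℝ (⊤ : ℕ∞) P) {g : ℝ × E → ℝ}
  (hg : g = fun z : ℝ × E => α * (T₀ - z.1) * P (m z) + b * ‖z.2‖ ^ 2)

include hm hP hg

/-- The weight is smooth. [folklore] -/
theorem contDiff_cylWeight : ContDiff ℝ (⊤ : ℕ∞) g := by
  rw [hg]
  exact ((contDiff_const.mul (contDiff_const.sub contDiff_fst)).mul (hP.comp (contDiff_cylSq hm))).add
    (contDiff_const.mul contDiff_norm_sq_snd)

/-- **First derivatives of the weight**: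
`Dg(z)v = −αv₁P(m) + 2α(T₀−t)P'(m)(⟪x,v₂⟫ − ⟪x,a⟫⟪v₂,a⟫) + 2b⟪x,v₂⟫`. [cite: Palasek2021, §4 (proof of Prop 9)] -/
theorem fderiv_cylWeight_apply (z v : ℝ × E) :
    fderiv ℝ g z v = -α * v.1 * P (m z) +
      2 * α * (T₀ - z.1) * deriv P (m z) * (⟪z.2, v.2⟫ - ⟪z.2, a⟫ * ⟪v.2, a⟫) + 2 * b * ⟪z.2, v.2⟫ := by
  rw [hg]
  have hPd : Differentiable ℝ P := hP.differentiable (by simp)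
  have hN : DifferentiableAt ℝ (fun y : ℝ × E => ‖y.2‖ ^ 2) z :=
    (contDiff_norm_sq_snd (E := E) (n := 1)).differentiable one_ne_zero z
  have hM : DifferentiableAt ℝ m z := (contDiff_cylSq hm (n := 1)).differentiable one_ne_zero z
  have hPn : DifferentiableAt ℝ (fun y : ℝ × E => P (m y)) z := (hPd _).comp z hM
  have hτ1 : DifferentiableAt ℝ (fun t : ℝ => α * (T₀ - t)) z.1 := by fun_prop
  have hτ : DifferentiableAt ℝ (fun y : ℝ × E => α * (T₀ - y.1)) z := hτ1.comp z differentiableAt_fst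
  have hprod : DifferentiableAt ℝ (fun y : ℝ × E => α * (T₀ - y.1) * P (m y)) z := hτ.mul hPn
  have hbN : DifferentiableAt ℝ (fun y : ℝ × E => b * ‖y.2‖ ^ 2) z := hN.const_mul b
  rw [fderiv_fun_add hprod hbN]
  simp only [_root_.add_apply]
  rw [fderiv_mul_apply' hτ hPn, fderiv_comp_fst_apply' hτ1, fderiv_comp_scalar_apply (hPd _) hM,
    fderiv_cylSq_apply hm, fderiv_const_mul hN]
  simp only [_root_.smul_apply, smul_eq_mul, fderiv_norm_sq_snd_apply]
  have hdτ : deriv (fun t : ℝ => α * (T₀ - t)) z.1 = -α := by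
    have : HasDerivAt (fun t : ℝ => α * (T₀ - t)) (α * (0 - 1)) z.1 :=
      ((hasDerivAt_const _ T₀).sub (hasDerivAt_id _)).const_mul α
    rw [this.deriv]
    ring
  rw [hdτ]
  ring

/-- `∂ₜg = −αP(m)`. [cite: Palasek2021, §4 (proof of Prop 9)] -/
theorem dt_cylWeight (z : ℝ × E) : dt g z = -α * P (m z) := by
  rw [dt_apply, fderiv_cylWeight_apply hm hP hg]
  simp

/-- `∂ₑg = 2α(T₀−t)P'(m)(⟪x,e⟫ − ⟪x,a⟫⟪e,a⟫) + 2b⟪x,e⟫`. [cite: Palasek2021, §4 (proof of Prop 9)] -/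
theorem dx_cylWeight (z : ℝ × E) (e : E) :
    dx e g z = 2 * α * (T₀ - z.1) * deriv P (m z) * (⟪z.2, e⟫ - ⟪z.2, a⟫ * ⟪e, a⟫) + 2 * b * ⟪z.2, e⟫ := by
  rw [dx_apply, fderiv_cylWeight_apply hm hP hg]
  simp

/-- **Second spatial derivatives of the weight**:
`∂ₑ'∂ₑg = 4α(T₀−t)P''(m) wₑ' wₑ + 2α(T₀−t)P'(m)(⟪e',e⟫ − ⟪e',a⟫⟪e,a⟫) + 2b⟪e',e⟫`,
`wₑ = ⟪x,e⟫ − ⟪x,a⟫⟪e,a⟫`. [cite: Palasek2021, §4 (proof of Prop 9)] -/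
theorem dxdx_cylWeight (z : ℝ × E) (e e' : E) :
    dx e' (dx e g) z =
      4 * α * (T₀ - z.1) * deriv (deriv P) (m z) * (⟪z.2, e'⟫ - ⟪z.2, a⟫ * ⟪e', a⟫) *
          (⟪z.2, e⟫ - ⟪z.2, a⟫ * ⟪e, a⟫) +
        2 * α * (T₀ - z.1) * deriv P (m z) * (⟪e', e⟫ - ⟪e', a⟫ * ⟪e, a⟫) + 2 * b * ⟪e', e⟫ := by
  -- `∂ₑg = c(y) ⟪y.2, ẽ⟫ + 2b ⟪y.2, e⟫` with `ẽ = e − ⟪e,a⟫a`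
  have hlin : ∀ y : ℝ × E, ⟪y.2, e⟫ - ⟪y.2, a⟫ * ⟪e, a⟫ = ⟪y.2, e - ⟪e, a⟫ • a⟫ := fun y => by
    rw [inner_sub_right, real_inner_smul_right]
    ring
  have hfun : dx e g = fun y : ℝ × E =>
      (2 * α * (T₀ - y.1) * deriv P (m y)) * ⟪y.2, e - ⟪e, a⟫ • a⟫ + 2 * b * ⟪y.2, e⟫ :=
    funext fun y => by rw [dx_cylWeight hm hP hg y e, hlin y]
  rw [dx_apply, hfun]
  have hP1 : ContDiff ℝ (⊤ : ℕ∞) (deriv P) := hP.iterate_deriv 1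
  have hP'd : Differentiable ℝ (deriv P) := hP1.differentiable (by simp)
  have hM : DifferentiableAt ℝ m z := (contDiff_cylSq hm (n := 1)).differentiable one_ne_zero z
  have hP'n : DifferentiableAt ℝ (fun y : ℝ × E => deriv P (m y)) z := (hP'd _).comp z hM
  have hτ1 : DifferentiableAt ℝ (fun t : ℝ => 2 * α * (T₀ - t)) z.1 := by fun_prop
  have hτ : DifferentiableAt ℝ (fun y : ℝ × E => 2 * α * (T₀ - y.1)) z := hτ1.comp z differentiableAt_fst
  have hc : DifferentiableAt ℝ (fun y : ℝ × E => 2 * α * (T₀ - y.1) * deriv P (m y)) z := hτ.mul hP'n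
  have hi : DifferentiableAt ℝ (fun y : ℝ × E => ⟪y.2, e - ⟪e, a⟫ • a⟫) z :=
    (contDiff_inner_snd_const _ (n := 1)).differentiable one_ne_zero z
  have hie : DifferentiableAt ℝ (fun y : ℝ × E => ⟪y.2, e⟫) z :=
    (contDiff_inner_snd_const _ (n := 1)).differentiable one_ne_zero z
  have hbie : DifferentiableAt ℝ (fun y : ℝ × E => 2 * b * ⟪y.2, e⟫) z := hie.const_mul _
  rw [fderiv_fun_add (hc.fun_mul hi) hbie]
  simp only [_root_.add_apply]
  rw [fderiv_mul_apply' hc hi, fderiv_inner_snd_const, fderiv_mul_apply' hτ hP'n,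
    fderiv_comp_fst_apply' hτ1, fderiv_comp_scalar_apply (hP'd _) hM, fderiv_cylSq_apply hm,
    fderiv_const_mul hie]
  simp only [_root_.smul_apply, smul_eq_mul, fderiv_inner_snd_const, zero_mul, mul_zero, zero_add]
  rw [← hlin (z.1, e'), hlin z]
  simp only
  rw [real_inner_comm e e']
  ring

variable [FiniteDimensional ℝ E]

include ha in
/-- `Δg = α(T₀−t)(4P''(m)m + 2(d−1)P'(m)) + 2bd`. [cite: Palasek2021, §4 (proof of Prop 9)] -/
theorem lap_cylWeight (z : ℝ × E) :
    lap g z = α * (T₀ - z.1) * (4 * deriv (deriv P) (m z) * m z + 2 * ((Module.finrank ℝ E : ℝ) - 1) * deriv P (m z)) +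
      2 * b * (Module.finrank ℝ E : ℝ) := by
  have hτs : ContDiff ℝ 2 fun t : ℝ => α * (T₀ - t) := by fun_prop
  have hP2 : ContDiff ℝ 2 P := hP.of_le (WithTop.coe_le_coe.2 le_top)
  have hM1 : ContDiff ℝ 2 fun y : ℝ × E => α * (T₀ - y.1) * P (m y) :=
    (hτs.comp contDiff_fst).mul (hP2.comp (contDiff_cylSq hm))
  have hM2 : ContDiff ℝ 2 fun y : ℝ × E => b * ‖y.2‖ ^ 2 := contDiff_const.mul contDiff_norm_sq_snd
  rw [hg, lap_add_of_contDiff hM1 hM2, lap_timeCyl ha hm hτs hP2, (dt_lap_const_mul_norm_sq b z).2]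

include ha in
/-- `|∇g|² = 4α²(T₀−t)²P'(m)²m + 8bα(T₀−t)P'(m)m + 4b²|x|²`. [cite: Palasek2021, §4 (proof of Prop 9)] -/
theorem gradSq_cylWeight (z : ℝ × E) :
    gradSq g z = 4 * (α * (T₀ - z.1)) ^ 2 * deriv P (m z) ^ 2 * m z +
      8 * b * (α * (T₀ - z.1)) * deriv P (m z) * m z + 4 * b ^ 2 * ‖z.2‖ ^ 2 := by
  unfold gradSq
  simp only [dx_cylWeight hm hP hg, Real.norm_eq_abs, sq_abs]
  have hexp : ∀ i, (2 * α * (T₀ - z.1) * deriv P (m z) *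
      (⟪z.2, stdOrthonormalBasis ℝ E i⟫ - ⟪z.2, a⟫ * ⟪stdOrthonormalBasis ℝ E i, a⟫) +
        2 * b * ⟪z.2, stdOrthonormalBasis ℝ E i⟫) ^ 2 =
      4 * (α * (T₀ - z.1)) ^ 2 * deriv P (m z) ^ 2 *
          (⟪z.2, stdOrthonormalBasis ℝ E i⟫ - ⟪z.2, a⟫ * ⟪stdOrthonormalBasis ℝ E i, a⟫) ^ 2 +
        8 * b * (α * (T₀ - z.1)) * deriv P (m z) *
          (⟪z.2, stdOrthonormalBasis ℝ E i⟫ ^ 2 -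
            ⟪z.2, a⟫ * (⟪z.2, stdOrthonormalBasis ℝ E i⟫ * ⟪stdOrthonormalBasis ℝ E i, a⟫)) +
        4 * b ^ 2 * ⟪z.2, stdOrthonormalBasis ℝ E i⟫ ^ 2 := fun i => by ring
  simp only [hexp]
  rw [Finset.sum_add_distrib, Finset.sum_add_distrib, ← Finset.mul_sum, ← Finset.mul_sum, ← Finset.mul_sum,
    Finset.sum_sub_distrib, ← Finset.mul_sum, sum_sq_inner_proj ha, (stdOrthonormalBasis ℝ E).sum_sq_inner_left,
    (stdOrthonormalBasis ℝ E).sum_inner_mul_inner, hm]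
  simp only
  ring

include ha in
/-- **`F = ∂ₜg − Δg − |∇g|²` for the weight**, globally in terms of the profile. [cite: Palasek2021, §4 (proof of Prop 9)] -/
theorem Fg_cylWeight (z : ℝ × E) :
    dt g z - lap g z - gradSq g z = -α * P (m z) -
      α * (T₀ - z.1) * (4 * deriv (deriv P) (m z) * m z + 2 * ((Module.finrank ℝ E : ℝ) - 1) * deriv P (m z)) -
      2 * b * (Module.finrank ℝ E : ℝ) -
      (4 * (α * (T₀ - z.1)) ^ 2 * deriv P (m z) ^ 2 * m z +
        8 * b * (α * (T₀ - z.1)) * deriv P (m z) * m z + 4 * b ^ 2 * ‖z.2‖ ^ 2) := by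
  rw [dt_cylWeight hm hP hg, lap_cylWeight ha hm hP hg, gradSq_cylWeight ha hm hP hg]
  ring

end Weight

/-! #### Values on the region `m > r²/4`, where `P(m) = √m` is the distance to the axis -/

section Region

variable {a : E} (ha : ‖a‖ = 1) {m : ℝ × E → ℝ} (hm : m = fun y : ℝ × E => ‖y.2‖ ^ 2 - ⟪y.2, a⟫ ^ 2)
variable {α T₀ b : ℝ} {P : ℝ → ℝ} (hP : ContDiff ℝ (⊤ : ℕ∞) P) {g : ℝ × E → ℝ}
  (hg : g = fun z : ℝ × E => α * (T₀ - z.1) * P (m z) + b * ‖z.2‖ ^ 2)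
variable {r : ℝ} (hr : 0 < r)
  (hreg : ∀ s, r ^ 2 / 4 < s → P s = Real.sqrt s ∧ deriv P s = 1 / (2 * Real.sqrt s) ∧
    deriv (deriv P) s = -1 / (4 * s * Real.sqrt s) ∧ deriv (deriv (deriv P)) s = 3 / (8 * s ^ 2 * Real.sqrt s))

omit [NormedAddCommGroup E] [InnerProductSpace ℝ E] [InnerProductSpace ℝ F] in
include hr in
/-- On `m > r²/4`: `√m > 0` and `(√m)² = m`. [folklore] -/
theorem sqrt_cylSq_region {z : ℝ × E} (hz : r ^ 2 / 4 < m z) :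
    0 < Real.sqrt (m z) ∧ Real.sqrt (m z) ^ 2 = m z := by
  have h0 : 0 < m z := lt_trans (by positivity) hz
  exact ⟨Real.sqrt_pos.2 h0, Real.sq_sqrt h0.le⟩

include hm hP hg hr hreg in
/-- Region values: `∂ₜg = −α√m`, `∂ₑg = (α(T₀−t)/√m) wₑ + 2b⟪x,e⟫`,
`∂ₑ'∂ₑg = −α(T₀−t) wₑ' wₑ/√m³ + (α(T₀−t)/√m)(⟪e',e⟫ − ⟪e',a⟫⟪e,a⟫) + 2b⟪e',e⟫`. [cite: Palasek2021, §4 (proof of Prop 9)] -/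
theorem cylWeight_region_first {z : ℝ × E} (hz : r ^ 2 / 4 < m z) (e e' : E) :
    dt g z = -α * Real.sqrt (m z) ∧
      dx e g z = α * (T₀ - z.1) / Real.sqrt (m z) * (⟪z.2, e⟫ - ⟪z.2, a⟫ * ⟪e, a⟫) + 2 * b * ⟪z.2, e⟫ ∧
      dx e' (dx e g) z = -α * (T₀ - z.1) * (⟪z.2, e'⟫ - ⟪z.2, a⟫ * ⟪e', a⟫) * (⟪z.2, e⟫ - ⟪z.2, a⟫ * ⟪e, a⟫) /
          Real.sqrt (m z) ^ 3 +
        α * (T₀ - z.1) / Real.sqrt (m z) * (⟪e', e⟫ - ⟪e', a⟫ * ⟪e, a⟫) + 2 * b * ⟪e', e⟫ := by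
  obtain ⟨hn, hs⟩ := sqrt_cylSq_region hr hz
  obtain ⟨h0, h1, h2, -⟩ := hreg _ hz
  rw [dt_cylWeight hm hP hg, dx_cylWeight hm hP hg, dxdx_cylWeight hm hP hg, h0, h1, h2]
  generalize Real.sqrt (m z) = ρ at hn hs ⊢
  rw [← hs]
  have hρ0 : ρ ≠ 0 := hn.ne'
  refine ⟨rfl, ?_, ?_⟩
  · field_simp
  · field_simp

variable [FiniteDimensional ℝ E]

include ha hm hP hg hr hreg in
/-- Region values: `Δg = (d−2)α(T₀−t)/√m + 2bd`, `|∇g|² = α²(T₀−t)² + 4bα(T₀−t)√m + 4b²|x|²`,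
`F = −α√m − (d−2)α(T₀−t)/√m − 2bd − α²(T₀−t)² − 4bα(T₀−t)√m − 4b²|x|²` (Palasek, `d₁ = d − 1 = 2`,
`d₂ = 1`: "`F = −αr − α(T₀−t)(d₁−1)/r − 2(d₁+d₂)b − α²(T₀−t)² − 4b²|x|² − 4bα(T₀−t)r`"). [cite: Palasek2021, §4 (proof of Prop 9)] -/
theorem cylWeight_region_second {z : ℝ × E} (hz : r ^ 2 / 4 < m z) :
    lap g z = ((Module.finrank ℝ E : ℝ) - 2) * α * (T₀ - z.1) / Real.sqrt (m z) + 2 * b * (Module.finrank ℝ E : ℝ) ∧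
      gradSq g z = (α * (T₀ - z.1)) ^ 2 + 4 * b * (α * (T₀ - z.1)) * Real.sqrt (m z) + 4 * b ^ 2 * ‖z.2‖ ^ 2 ∧
      dt g z - lap g z - gradSq g z = -α * Real.sqrt (m z) -
        ((Module.finrank ℝ E : ℝ) - 2) * α * (T₀ - z.1) / Real.sqrt (m z) - 2 * b * (Module.finrank ℝ E : ℝ) -
        (α * (T₀ - z.1)) ^ 2 - 4 * b * (α * (T₀ - z.1)) * Real.sqrt (m z) - 4 * b ^ 2 * ‖z.2‖ ^ 2 := by
  obtain ⟨hn, hs⟩ := sqrt_cylSq_region hr hz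
  obtain ⟨h0, h1, h2, -⟩ := hreg _ hz
  have e0 := dt_cylWeight hm hP hg z
  have e1 := lap_cylWeight ha hm hP hg z
  have e2 := gradSq_cylWeight ha hm hP hg z
  rw [e0, e1, e2, h0, h1, h2]
  generalize Real.sqrt (m z) = ρ at hn hs ⊢
  rw [← hs]
  have hρ0 : ρ ≠ 0 := hn.ne'
  refine ⟨?_, ?_, ?_⟩
  · field_simp
    ring
  · field_simp
    ring
  · field_simp
    ring

include ha hm hP hg hr hreg in
/-- **Convexity of the distance to the axis** (Palasek: "Since the function `r` is convex, we have
`D²g ≥ (2/(C₀T))Id` as quadratic forms"): for `t ≤ T₀`, `α ≥ 0` and `m > r²/4`,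
`Σᵢⱼ ∂ᵢ∂ⱼg ⟪Xᵢ, Xⱼ⟫ ≥ 2b Σᵢ |Xᵢ|²`. [cite: Palasek2021, §4 (proof of Prop 9)] -/
theorem D2_cylWeight_ge (hα : 0 ≤ α) {z : ℝ × E} (hz : r ^ 2 / 4 < m z) (ht : z.1 ≤ T₀)
    (X : Fin (Module.finrank ℝ E) → F) :
    2 * b * ∑ i, ‖X i‖ ^ 2 ≤ ∑ i, ∑ j, dx (stdOrthonormalBasis ℝ E i) (dx (stdOrthonormalBasis ℝ E j) g) z *
      ⟪X i, X j⟫ := by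
  obtain ⟨hn, hs⟩ := sqrt_cylSq_region hr hz
  set bs := stdOrthonormalBasis ℝ E with hbs
  set τ : ℝ := α * (T₀ - z.1) with hτ
  set ρ : ℝ := Real.sqrt (m z) with hρ
  have hτ0 : 0 ≤ τ := mul_nonneg hα (by linarith)
  -- coefficient vectors
  set w : Fin (Module.finrank ℝ E) → ℝ := fun i => ⟪z.2, bs i⟫ - ⟪z.2, a⟫ * ⟪bs i, a⟫ with hw
  set c : Fin (Module.finrank ℝ E) → ℝ := fun i => ⟪bs i, a⟫ with hc
  have hc1 : ∑ i, c i ^ 2 = 1 := by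
    have := bs.sum_sq_inner_left a
    rw [ha, one_pow] at this
    rw [← this]
    exact Finset.sum_congr rfl fun i _ => by rw [hc, real_inner_comm]
  have hcw : ∑ i, c i * w i = 0 := by
    simp only [hc, hw, mul_sub]
    rw [Finset.sum_sub_distrib]
    have h1 : ∑ i, ⟪bs i, a⟫ * ⟪z.2, bs i⟫ = ⟪z.2, a⟫ := by
      rw [← bs.sum_inner_mul_inner z.2 a]
      exact Finset.sum_congr rfl fun i _ => by ring
    have h2 : ∑ i, ⟪bs i, a⟫ * (⟪z.2, a⟫ * ⟪bs i, a⟫) = ⟪z.2, a⟫ * ∑ i, c i ^ 2 := by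
      rw [Finset.mul_sum]
      exact Finset.sum_congr rfl fun i _ => by rw [hc]; ring
    rw [h1, h2, hc1, mul_one, sub_self]
  have hw2 : ∑ i, w i ^ 2 = m z := by
    simp only [hw]
    rw [sum_sq_inner_proj ha, hm]
  -- the formula for the Hessian entries
  have hformula : ∀ i j, dx (bs i) (dx (bs j) g) z =
      -(τ / ρ ^ 3) * (w i * w j) + τ / ρ * (⟪bs i, bs j⟫ - c i * c j) + 2 * b * ⟪bs i, bs j⟫ := by
    intro i j
    rw [(cylWeight_region_first hm hP hg hr hreg hz (bs j) (bs i)).2.2]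
    simp only [hw, hc, hτ, hρ]
    ring
  have hsplit : ∑ i, ∑ j, dx (bs i) (dx (bs j) g) z * ⟪X i, X j⟫ =
      -(τ / ρ ^ 3) * ∑ i, ∑ j, w i * w j * ⟪X i, X j⟫ +
        τ / ρ * (∑ i, ∑ j, ⟪bs i, bs j⟫ * ⟪X i, X j⟫ - ∑ i, ∑ j, c i * c j * ⟪X i, X j⟫) +
        2 * b * ∑ i, ∑ j, ⟪bs i, bs j⟫ * ⟪X i, X j⟫ := by
    simp only [hformula, Finset.mul_sum, ← Finset.sum_sub_distrib, ← Finset.sum_add_distrib]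
    refine Finset.sum_congr rfl fun i _ => Finset.sum_congr rfl fun j _ => ?_
    ring
  -- the `δᵢⱼ` sums
  have hδ : ∑ i, ∑ j, ⟪bs i, bs j⟫ * ⟪X i, X j⟫ = ∑ i, ‖X i‖ ^ 2 := by
    refine Finset.sum_congr rfl fun i _ => ?_
    rw [Finset.sum_eq_single i]
    · simp only [real_inner_self_eq_norm_sq, bs.orthonormal.1 i, one_pow, one_mul]
    · intro j _ hji
      rw [orthonormal_iff_ite.1 bs.orthonormal i j, if_neg (Ne.symm hji)]
      ring
    · intro h
      exact absurd (Finset.mem_univ i) h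
  -- the rank-one sums
  have hrank : ∀ v : Fin (Module.finrank ℝ E) → ℝ,
      ∑ i, ∑ j, v i * v j * ⟪X i, X j⟫ = ‖∑ i, v i • X i‖ ^ 2 := fun v => by
    rw [← real_inner_self_eq_norm_sq, sum_inner]
    simp only [inner_sum, real_inner_smul_left, real_inner_smul_right]
    refine Finset.sum_congr rfl fun i _ => Finset.sum_congr rfl fun j _ => ?_
    ring
  rw [hsplit, hδ, hrank w, hrank c]
  -- the convexity inequality
  have key := norm_sq_sum_smul_add_le c w X hc1 hcw
  rw [hw2] at key
  have hρm : ρ ^ 2 = m z := hs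
  have hρ3 : ρ ^ 3 = ρ * m z := by rw [← hρm]; ring
  have hX0 : 0 ≤ ∑ i, ‖X i‖ ^ 2 := Finset.sum_nonneg fun i _ => sq_nonneg _
  -- `τ/ρ (Σ‖X‖² − ‖A‖²) − τ/ρ³ ‖W‖² = τ/(ρ m) (m(Σ‖X‖² − ‖A‖²) − ‖W‖²) ≥ 0`
  have hdiff : 0 ≤ m z * (∑ i, ‖X i‖ ^ 2 - ‖∑ i, c i • X i‖ ^ 2) - ‖∑ i, w i • X i‖ ^ 2 := by nlinarith [key]
  have hmpos : 0 < m z := by nlinarith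
  have hcoef : 0 ≤ τ / (ρ * m z) := div_nonneg hτ0 (mul_pos hn hmpos).le
  have hmain : -(τ / ρ ^ 3) * ‖∑ i, w i • X i‖ ^ 2 +
      τ / ρ * (∑ i, ‖X i‖ ^ 2 - ‖∑ i, c i • X i‖ ^ 2) =
      τ / (ρ * m z) * (m z * (∑ i, ‖X i‖ ^ 2 - ‖∑ i, c i • X i‖ ^ 2) - ‖∑ i, w i • X i‖ ^ 2) := by
    rw [hρ3]
    have hm0 : m z ≠ 0 := hmpos.ne'
    have hρ0 : ρ ≠ 0 := hn.ne'
    field_simp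
    ring
  have := mul_nonneg hcoef hdiff
  rw [← hmain] at this
  linarith

end Region

/-! ### `LF = ∂ₜF + ΔF` on the region -/

section LF

variable [FiniteDimensional ℝ E]
variable {a : E} (ha : ‖a‖ = 1) {m : ℝ × E → ℝ} (hm : m = fun y : ℝ × E => ‖y.2‖ ^ 2 - ⟪y.2, a⟫ ^ 2)
variable {α T₀ b : ℝ} {P : ℝ → ℝ} (hP : ContDiff ℝ (⊤ : ℕ∞) P) {g : ℝ × E → ℝ}
  (hg : g = fun z : ℝ × E => α * (T₀ - z.1) * P (m z) + b * ‖z.2‖ ^ 2)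
  {r : ℝ} (hr : 0 < r)
  (hreg : ∀ s, r ^ 2 / 4 < s → P s = Real.sqrt s ∧ deriv P s = 1 / (2 * Real.sqrt s) ∧
    deriv (deriv P) s = -1 / (4 * s * Real.sqrt s) ∧ deriv (deriv (deriv P)) s = 3 / (8 * s ^ 2 * Real.sqrt s))
  {Φ : ℝ × E → ℝ}
  (hΦ : Φ = fun z : ℝ × E => -(α + 4 * b * α * (T₀ - z.1)) * P (m z) +
    -(2 * ((Module.finrank ℝ E : ℝ) - 2) * α * (T₀ - z.1)) * deriv P (m z) +
    (-(2 * b * (Module.finrank ℝ E : ℝ)) - (α * (T₀ - z.1)) ^ 2) + -(4 * b ^ 2) * ‖z.2‖ ^ 2)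

include ha hm hP hg hr hreg hΦ in
/-- **On the region, `F` is the smooth global function `Φ`** built from the profile:
`F = −(α + 4bα(T₀−t))P − 2(d−2)α(T₀−t)P' − 2bd − α²(T₀−t)² − 4b²|x|²`. [cite: Palasek2021, §4 (proof of Prop 9)] -/
theorem Fg_eq_Phi_region {z : ℝ × E} (hz : r ^ 2 / 4 < m z) : dt g z - lap g z - gradSq g z = Φ z := by
  obtain ⟨hn, hs⟩ := sqrt_cylSq_region hr hz
  obtain ⟨h0, h1, -, -⟩ := hreg _ hz
  rw [(cylWeight_region_second ha hm hP hg hr hreg hz).2.2, hΦ]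
  simp only [h0, h1]
  have hn0 : Real.sqrt (m z) ≠ 0 := hn.ne'
  field_simp
  ring

include hm hP hΦ in
omit [FiniteDimensional ℝ E] in
/-- The global function `Φ` is smooth. [folklore] -/
theorem contDiff_Phi_top : ContDiff ℝ (⊤ : ℕ∞) Φ := by
  rw [hΦ]
  have hP' : ContDiff ℝ (⊤ : ℕ∞) (deriv P) := hP.iterate_deriv 1
  have hM : ContDiff ℝ (⊤ : ℕ∞) m := contDiff_cylSq hm
  have hN : ContDiff ℝ (⊤ : ℕ∞) fun y : ℝ × E => ‖y.2‖ ^ 2 := contDiff_norm_sq_snd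
  refine (((?_ : ContDiff ℝ (⊤ : ℕ∞) _).add ?_).add ?_).add (contDiff_const.mul hN)
  · exact ((contDiff_const.add ((contDiff_const.mul (contDiff_const.sub contDiff_fst)))).neg).mul (hP.comp hM)
  · exact ((contDiff_const.mul (contDiff_const.sub contDiff_fst)).neg).mul (hP'.comp hM)
  · exact contDiff_const.sub ((contDiff_const.mul (contDiff_const.sub contDiff_fst)).pow 2)

include hm hP hΦ in
omit [FiniteDimensional ℝ E] in
/-- The global function `Φ` is `C²`. [folklore] -/
theorem contDiff_Phi : ContDiff ℝ 2 Φ :=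
  (contDiff_Phi_top hm hP hΦ).of_le (WithTop.coe_le_coe.2 le_top)

include ha hm hP hΦ in
/-- **`LΦ = ∂ₜΦ + ΔΦ`, globally, in terms of the profile.** [cite: Palasek2021, §4 (proof of Prop 9)] -/
theorem dt_add_lap_Phi (z : ℝ × E) :
    dt Φ z + lap Φ z =
      (4 * b * α * P (m z) - (α + 4 * b * α * (T₀ - z.1)) *
          (4 * deriv (deriv P) (m z) * m z + 2 * ((Module.finrank ℝ E : ℝ) - 1) * deriv P (m z))) +
        (2 * ((Module.finrank ℝ E : ℝ) - 2) * α * deriv P (m z) -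
          2 * ((Module.finrank ℝ E : ℝ) - 2) * α * (T₀ - z.1) *
            (4 * deriv (deriv (deriv P)) (m z) * m z +
              2 * ((Module.finrank ℝ E : ℝ) - 1) * deriv (deriv P) (m z))) +
        2 * α ^ 2 * (T₀ - z.1) - 8 * b ^ 2 * (Module.finrank ℝ E : ℝ) := by
  set d : ℝ := (Module.finrank ℝ E : ℝ) with hd
  have hP2 : ContDiff ℝ 2 P := hP.of_le (WithTop.coe_le_coe.2 le_top)
  have hP'2 : ContDiff ℝ 2 (deriv P) := (hP.iterate_deriv 1).of_le (WithTop.coe_le_coe.2 le_top)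
  have hM2 : ContDiff ℝ 2 m := contDiff_cylSq hm
  have hN : ContDiff ℝ 2 fun y : ℝ × E => ‖y.2‖ ^ 2 := contDiff_norm_sq_snd
  -- the four pieces
  set τ₁ : ℝ → ℝ := fun t => -(α + 4 * b * α * (T₀ - t)) with hτ₁
  set τ₂ : ℝ → ℝ := fun t => -(2 * (d - 2) * α * (T₀ - t)) with hτ₂
  set τ₃ : ℝ → ℝ := fun t => -(2 * b * d) - (α * (T₀ - t)) ^ 2 with hτ₃
  have hτ₁s : ContDiff ℝ 2 τ₁ := by rw [hτ₁]; fun_prop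
  have hτ₂s : ContDiff ℝ 2 τ₂ := by rw [hτ₂]; fun_prop
  have hτ₃s : ContDiff ℝ 2 τ₃ := by rw [hτ₃]; fun_prop
  have hτ₁d : deriv τ₁ z.1 = 4 * b * α := by
    have : HasDerivAt τ₁ (-(0 + 4 * b * α * (0 - 1))) z.1 :=
      ((hasDerivAt_const _ α).add (((hasDerivAt_const _ T₀).sub (hasDerivAt_id _)).const_mul _)).neg
    rw [this.deriv]
    ring
  have hτ₂d : deriv τ₂ z.1 = 2 * (d - 2) * α := by
    have : HasDerivAt τ₂ (-(2 * (d - 2) * α * (0 - 1))) z.1 :=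
      (((hasDerivAt_const _ T₀).sub (hasDerivAt_id _)).const_mul _).neg
    rw [this.deriv]
    ring
  have hτ₃d : deriv τ₃ z.1 = 2 * α ^ 2 * (T₀ - z.1) := by
    have : HasDerivAt τ₃ (0 - 2 * (α * (T₀ - z.1)) ^ 1 * (α * (0 - 1))) z.1 :=
      (hasDerivAt_const _ _).sub ((((hasDerivAt_const _ T₀).sub (hasDerivAt_id _)).const_mul α).pow 2)
    rw [this.deriv]
    ring
  set M₁ : ℝ × E → ℝ := fun y => τ₁ y.1 * P (m y) with hM₁
  set M₂ : ℝ × E → ℝ := fun y => τ₂ y.1 * deriv P (m y) with hM₂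
  set M₃ : ℝ × E → ℝ := fun y => τ₃ y.1 with hM₃
  set M₄ : ℝ × E → ℝ := fun y => -(4 * b ^ 2) * ‖y.2‖ ^ 2 with hM₄
  have hM₁s : ContDiff ℝ 2 M₁ := (hτ₁s.comp contDiff_fst).mul (hP2.comp hM2)
  have hM₂s : ContDiff ℝ 2 M₂ := (hτ₂s.comp contDiff_fst).mul (hP'2.comp hM2)
  have hM₃s : ContDiff ℝ 2 M₃ := hτ₃s.comp contDiff_fst
  have hM₄s : ContDiff ℝ 2 M₄ := contDiff_const.mul hN
  have hΦeq : Φ = fun y => ((M₁ y + M₂ y) + M₃ y) + M₄ y := by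
    rw [hΦ]
  -- derivatives of the pieces
  have d1 : dt M₁ z = 4 * b * α * P (m z) := by rw [hM₁, dt_timeCyl hm hτ₁s hP2, hτ₁d]
  have l1 : lap M₁ z = τ₁ z.1 * (4 * deriv (deriv P) (m z) * m z + 2 * (d - 1) * deriv P (m z)) := by
    rw [hM₁, lap_timeCyl ha hm hτ₁s hP2]
  have d2 : dt M₂ z = 2 * (d - 2) * α * deriv P (m z) := by rw [hM₂, dt_timeCyl hm hτ₂s hP'2, hτ₂d]
  have l2 : lap M₂ z = τ₂ z.1 * (4 * deriv (deriv (deriv P)) (m z) * m z +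
      2 * (d - 1) * deriv (deriv P) (m z)) := by
    rw [hM₂, lap_timeCyl ha hm hτ₂s hP'2]
  obtain ⟨d3, l3⟩ := dt_lap_timeOnly (E := E) hτ₃s z
  obtain ⟨d4, l4⟩ := dt_lap_const_mul_norm_sq (E := E) (-(4 * b ^ 2)) z
  -- additivity
  have hD12 : Differentiable ℝ fun y => M₁ y + M₂ y := (hM₁s.add hM₂s).differentiable (by norm_num)
  have hD123 : Differentiable ℝ fun y => (M₁ y + M₂ y) + M₃ y := ((hM₁s.add hM₂s).add hM₃s).differentiable (by norm_num)
  have hdt : dt Φ z = dt M₁ z + dt M₂ z + dt M₃ z + dt M₄ z := by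
    rw [hΦeq, dt_add_of_differentiable hD123 (hM₄s.differentiable (by norm_num)),
      dt_add_of_differentiable hD12 (hM₃s.differentiable (by norm_num)),
      dt_add_of_differentiable (hM₁s.differentiable (by norm_num)) (hM₂s.differentiable (by norm_num))]
  have hlap : lap Φ z = lap M₁ z + lap M₂ z + lap M₃ z + lap M₄ z := by
    rw [hΦeq, lap_add_of_contDiff ((hM₁s.add hM₂s).add hM₃s) hM₄s, lap_add_of_contDiff (hM₁s.add hM₂s) hM₃s,
      lap_add_of_contDiff hM₁s hM₂s]
  rw [hdt, hlap, d1, l1, d2, l2, d3, l3, d4, l4, hτ₃d]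
  simp only [hτ₁, hτ₂]
  ring

include ha hm hP hg hr hreg hΦ in
/-- **`LF` on the region** (Palasek, `d₁ = d − 1`, `d₂ = 1`:
"`LF = r₊²(T₀−t)/(2C₀²T⁴) + 2r₊r/(C₀²T³) − (r₊(T₀−t)/(2C₀T²))(d₁−1)(3−d₁)/r³ − 8(d₁+d₂)/(C₀²T²) −
2r₊(T₀−t)(d₁−1)/(C₀²T³r)`"): for `m > r²/4`,
`∂ₜF + ΔF = 2α²(T₀−t) + 4bα√m − 4(d−2)bα(T₀−t)/√m − (d−2)(4−d)α(T₀−t)/√m³ − 8b²d`. [cite: Palasek2021, §4 (proof of Prop 9)] -/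
theorem LF_region {z : ℝ × E} (hz : r ^ 2 / 4 < m z) :
    dt (fun y => dt g y - lap g y - gradSq g y) z + lap (fun y => dt g y - lap g y - gradSq g y) z =
      2 * α ^ 2 * (T₀ - z.1) + 4 * b * α * Real.sqrt (m z) -
        4 * ((Module.finrank ℝ E : ℝ) - 2) * b * α * (T₀ - z.1) / Real.sqrt (m z) -
        ((Module.finrank ℝ E : ℝ) - 2) * (4 - (Module.finrank ℝ E : ℝ)) * α * (T₀ - z.1) / Real.sqrt (m z) ^ 3 -
        8 * b ^ 2 * (Module.finrank ℝ E : ℝ) := by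
  -- the region is open and `F = Φ` on it
  have hV : IsOpen {y : ℝ × E | r ^ 2 / 4 < m y} := isOpen_lt continuous_const (contDiff_cylSq hm (n := 0)).continuous
  have hEq : EqOn (fun y => dt g y - lap g y - gradSq g y) Φ {y : ℝ × E | r ^ 2 / 4 < m y} :=
    fun y hy => Fg_eq_Phi_region ha hm hP hg hr hreg hΦ hy
  rw [dt_congr_of_eqOn hV hEq hz, lap_congr_of_eqOn hV hEq hz, dt_add_lap_Phi ha hm hP hΦ]
  obtain ⟨hn, hs⟩ := sqrt_cylSq_region hr hz
  obtain ⟨h0, h1, h2, h3⟩ := hreg _ hz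
  rw [h0, h1, h2, h3]
  generalize Real.sqrt (m z) = ρ at hn hs ⊢
  rw [← hs]
  have hρ0 : ρ ≠ 0 := hn.ne'
  field_simp
  ring

end LF

/-! ### The specialised Carleman inequality for the cylindrical weight -/

section CylCarleman

variable [FiniteDimensional ℝ E] [MeasurableSpace E] [BorelSpace E]
variable {a : E} (ha : ‖a‖ = 1) {m : ℝ × E → ℝ} (hm : m = fun y : ℝ × E => ‖y.2‖ ^ 2 - ⟪y.2, a⟫ ^ 2)
variable {α T₀ b : ℝ} {P : ℝ → ℝ} (hP : ContDiff ℝ (⊤ : ℕ∞) P) {g : ℝ × E → ℝ}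
  (hg : g = fun z : ℝ × E => α * (T₀ - z.1) * P (m z) + b * ‖z.2‖ ^ 2)
  {r : ℝ} (hr : 0 < r)
  (hreg : ∀ s, r ^ 2 / 4 < s → P s = Real.sqrt s ∧ deriv P s = 1 / (2 * Real.sqrt s) ∧
    deriv (deriv P) s = -1 / (4 * s * Real.sqrt s) ∧ deriv (deriv (deriv P)) s = 3 / (8 * s ^ 2 * Real.sqrt s))
  {Φ : ℝ × E → ℝ}
  (hΦ : Φ = fun z : ℝ × E => -(α + 4 * b * α * (T₀ - z.1)) * P (m z) +
    -(2 * ((Module.finrank ℝ E : ℝ) - 2) * α * (T₀ - z.1)) * deriv P (m z) +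
    (-(2 * b * (Module.finrank ℝ E : ℝ)) - (α * (T₀ - z.1)) ^ 2) + -(4 * b ^ 2) * ‖z.2‖ ^ 2)
variable {a₀ b₀ : ℝ} {W : ℝ × E → F} {K : Set E}
  (hW : ContDiffOn ℝ 2 W (Ioo a₀ b₀ ×ˢ univ)) (hK : IsCompact K)
  (hWK : ∀ s ∈ Ioo a₀ b₀, ∀ x ∉ K, W (s, x) = 0)
  (hW0 : ∀ s ∈ Ioo a₀ b₀, ∀ x : E, m (s, x) ≤ r ^ 2 → W (s, x) = 0)

include hm hW0 in
omit [FiniteDimensional ℝ E] [MeasurableSpace E] [BorelSpace E] in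
/-- Inside `m < r²` the cut-off field and its spatial derivatives vanish. [folklore] -/
theorem cylCutoffField_inner_vanish {t : ℝ} (ht : t ∈ Ioo a₀ b₀) {x : E} (hx : m (t, x) < r ^ 2) (e : E) :
    W (t, x) = 0 ∧ dx e W (t, x) = 0 := by
  refine ⟨hW0 t ht x hx.le, ?_⟩
  have hmx : ∀ s : ℝ, ∀ y : E, m (s, y) = ‖y‖ ^ 2 - ⟪y, a⟫ ^ 2 := fun s y => by rw [hm]
  have hcl : IsClosed {y : E | r ^ 2 ≤ ‖y‖ ^ 2 - ⟪y, a⟫ ^ 2} :=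
    isClosed_le continuous_const ((continuous_norm.pow 2).sub ((continuous_id.inner continuous_const).pow 2))
  have hsupp : ∀ s ∈ Ioo a₀ b₀, ∀ y ∉ {y : E | r ^ 2 ≤ ‖y‖ ^ 2 - ⟪y, a⟫ ^ 2}, W (s, y) = 0 := fun s hs y hy =>
    hW0 s hs y (by rw [hmx]; exact le_of_lt (not_le.1 hy))
  have hx' : x ∉ {y : E | r ^ 2 ≤ ‖y‖ ^ 2 - ⟪y, a⟫ ^ 2} := fun h => by
    rw [mem_setOf_eq, ← hmx t] at h
    exact absurd h (not_le.2 hx)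
  rw [dx_apply, fderiv_eq_zero_of_slice_support hcl hsupp ht hx']
  rfl

include ha hm hP hg hr hreg hΦ hW hK hWK hW0 in
/-- **The Carleman inequality for the cylindrical weight** (Tao's Lemma 4.1 = Palasek's Lemma 2 with
`g = α(T₀−t)P(m) + b|x|²`, the convexity bound `2D²g(∇W,∇W) ≥ 4b|∇W|²` and `F = Φ`,
`LF = ∂ₜΦ + ΔΦ` on the support of `W`): for `W` of class `C²` on the strip with compactly
supported slices vanishing on `m ≤ r²`, `α ≥ 0` and `t ≤ T₀`, the energy
`E(s) = ∫ (|∇W|² + ½Φ|W|²) eᵍ dx` is differentiable at `t` with derivative `D` and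
`∫ (½(∂ₜΦ + ΔΦ)|W|² + 4b|∇W|² − ½|LW|²) eᵍ dx ≤ D`. [cite: Palasek2021, Lemma 2 and §4 (proof of Prop 9)] -/
theorem cyl_carleman_rate (hα : 0 ≤ α) {t : ℝ} (ht : t ∈ Ioo a₀ b₀) (htT : t ≤ T₀) :
    ∃ D : ℝ, HasDerivAt (fun s => ∫ x, (gradSq W (s, x) + 1 / 2 * Φ (s, x) * ‖W (s, x)‖ ^ 2) *
        Real.exp (g (s, x))) D t ∧
      ∫ x, (1 / 2 * (dt Φ (t, x) + lap Φ (t, x)) * ‖W (t, x)‖ ^ 2 + 4 * b * gradSq W (t, x) -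
        1 / 2 * ‖dt W (t, x) + lap W (t, x)‖ ^ 2) * Real.exp (g (t, x)) ≤ D := by
  have hgs := contDiff_cylWeight hm hP hg
  have hg4 : ContDiffOn ℝ 4 g (Ioo a₀ b₀ ×ˢ univ) := (hgs.of_le (WithTop.coe_le_coe.2 le_top)).contDiffOn
  have hΦs := contDiff_Phi_top (E := E) hm hP hΦ
  set Fg : ℝ × E → ℝ := fun z => dt g z - lap g z - gradSq g z with hFg
  have h41 := hasDerivAt_energy hW hg4 hK hWK hFg ht
  have hineq := general_carleman_inequality hW hg4 hK hWK hFg ht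
  rw [h41.deriv] at hineq
  -- the region and the two cases
  have hV : IsOpen {y : ℝ × E | r ^ 2 / 4 < m y} := isOpen_lt continuous_const (contDiff_cylSq hm (n := 0)).continuous
  have hEqF : EqOn Fg Φ {y : ℝ × E | r ^ 2 / 4 < m y} := fun y hy => Fg_eq_Phi_region ha hm hP hg hr hreg hΦ hy
  have hcase : ∀ {s : ℝ}, s ∈ Ioo a₀ b₀ → ∀ x : E, r ^ 2 / 4 < m (s, x) ∨ m (s, x) < r ^ 2 := by
    intro s _ x
    by_cases h : r ^ 2 / 4 < m (s, x)
    · exact Or.inl h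
    · right
      push Not at h
      nlinarith
  -- `F |W|² = Φ |W|²` on the strip
  have hFΦ : ∀ {s : ℝ}, s ∈ Ioo a₀ b₀ → ∀ x : E, Fg (s, x) * ‖W (s, x)‖ ^ 2 = Φ (s, x) * ‖W (s, x)‖ ^ 2 := by
    intro s hs x
    rcases hcase hs x with hx | hx
    · rw [hEqF (show ((s, x) : ℝ × E) ∈ {y : ℝ × E | r ^ 2 / 4 < m y} from hx)]
    · rw [(cylCutoffField_inner_vanish hm hW0 hs hx 0).1, norm_zero, zero_pow two_ne_zero, mul_zero, mul_zero]
  refine ⟨_, h41.congr_of_eventuallyEq ?_, le_trans ?_ hineq⟩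
  · filter_upwards [isOpen_Ioo.mem_nhds ht] with s hs
    refine integral_congr_ae (Eventually.of_forall fun x => ?_)
    show (gradSq W (s, x) + 1 / 2 * Φ (s, x) * ‖W (s, x)‖ ^ 2) * Real.exp (g (s, x)) =
      (gradSq W (s, x) + 1 / 2 * Fg (s, x) * ‖W (s, x)‖ ^ 2) * Real.exp (g (s, x))
    rw [mul_assoc (1 / 2 : ℝ), mul_assoc (1 / 2 : ℝ), hFΦ hs x]
  · -- pointwise comparison of the two rate integrands
    have hpt : ∀ x : E, (1 / 2 * (dt Φ (t, x) + lap Φ (t, x)) * ‖W (t, x)‖ ^ 2 + 4 * b * gradSq W (t, x) -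
        1 / 2 * ‖dt W (t, x) + lap W (t, x)‖ ^ 2) * Real.exp (g (t, x)) ≤
        (1 / 2 * (dt Fg (t, x) + lap Fg (t, x)) * ‖W (t, x)‖ ^ 2 +
          2 * (∑ i, ∑ j, dx (stdOrthonormalBasis ℝ E i) (dx (stdOrthonormalBasis ℝ E j) g) (t, x) *
            ⟪dx (stdOrthonormalBasis ℝ E i) W (t, x), dx (stdOrthonormalBasis ℝ E j) W (t, x)⟫) -
          1 / 2 * ‖dt W (t, x) + lap W (t, x)‖ ^ 2) * Real.exp (g (t, x)) := by
      intro x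
      refine mul_le_mul_of_nonneg_right ?_ (Real.exp_pos _).le
      rcases hcase ht x with hx | hx
      · have hz : ((t, x) : ℝ × E) ∈ {y : ℝ × E | r ^ 2 / 4 < m y} := hx
        rw [dt_congr_of_eqOn hV hEqF hz, lap_congr_of_eqOn hV hEqF hz]
        have hD2 := D2_cylWeight_ge (F := F) ha hm hP hg hr hreg hα (z := (t, x)) hx htT
          (fun i => dx (stdOrthonormalBasis ℝ E i) W (t, x))
        have hgs' : ∑ i, ‖dx (stdOrthonormalBasis ℝ E i) W (t, x)‖ ^ 2 = gradSq W (t, x) := rfl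
        rw [hgs'] at hD2
        linarith
      · have h0 : ∀ e, dx e W (t, x) = 0 := fun e => (cylCutoffField_inner_vanish hm hW0 ht hx e).2
        have hW00 : W (t, x) = 0 := (cylCutoffField_inner_vanish hm hW0 ht hx 0).1
        have hgs0 : gradSq W (t, x) = 0 := by
          unfold gradSq
          exact Finset.sum_eq_zero fun i _ => by rw [h0, norm_zero, zero_pow two_ne_zero]
        simp only [h0, inner_zero_left, mul_zero, Finset.sum_const_zero, hW00, norm_zero, zero_pow two_ne_zero,
          hgs0, add_zero, le_refl]
    -- integrability of both integrands
    have hstrip : ∀ x : E, ((t, x) : ℝ × E) ∈ Ioo a₀ b₀ ×ˢ (univ : Set E) := fun x => mem_strip ht x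
    have cW : ContinuousOn W (Ioo a₀ b₀ ×ˢ univ) := hW.continuousOn
    have cN : ContinuousOn (fun z : ℝ × E => ‖W z‖ ^ 2) (Ioo a₀ b₀ ×ˢ univ) := (cW.norm).pow 2
    have cexp : ContinuousOn (fun z : ℝ × E => Real.exp (g z)) (Ioo a₀ b₀ ×ˢ univ) := continuousOn_expg hg4
    have cLW : ContinuousOn (fun z : ℝ × E => ‖dt W z + lap W z‖ ^ 2) (Ioo a₀ b₀ ×ˢ univ) :=
      (((continuousOn_dtU hW).add (continuousOn_lapU hW)).norm).pow 2
    have cgradW : ContinuousOn (gradSq W) (Ioo a₀ b₀ ×ˢ univ) := (contDiffOn_gradSqU hW).continuousOn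
    have cΦL : ContinuousOn (fun z : ℝ × E => dt Φ z + lap Φ z) (Ioo a₀ b₀ ×ˢ univ) := by
      have h1 : Continuous (dt Φ) := (contDiff_fderiv_apply_const hΦs (1, 0)).continuous
      have h2 : Continuous (lap Φ) := by
        rw [show lap Φ = fun z => ∑ i, dx (stdOrthonormalBasis ℝ E i) (dx (stdOrthonormalBasis ℝ E i) Φ) z
          from rfl]
        refine continuous_finsetSum _ fun i _ => ?_
        have : ContDiff ℝ (⊤ : ℕ∞) (dx (stdOrthonormalBasis ℝ E i) Φ) := contDiff_dx hΦs _
        exact (contDiff_fderiv_apply_const this (0, stdOrthonormalBasis ℝ E i)).continuous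
      exact (h1.add h2).continuousOn
    -- vanishing outside `K`
    have vW : ∀ x ∉ K, W (t, x) = 0 := hWK t ht
    have vdx : ∀ e, ∀ x ∉ K, dx e W (t, x) = 0 := fun e x hx => dxU_slice_support hK hWK e t ht x hx
    have vdt : ∀ x ∉ K, dt W (t, x) = 0 := fun x hx => dtU_slice_support hK hWK t ht x hx
    have vlap : ∀ x ∉ K, lap W (t, x) = 0 := fun x hx => by
      rw [show lap W (t, x) = ∑ i, dx (stdOrthonormalBasis ℝ E i) (dx (stdOrthonormalBasis ℝ E i) W) (t, x)
        from rfl]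
      exact Finset.sum_eq_zero fun i _ => by
        rw [dx_apply, fderiv_dxU_slice_support hK hWK _ _ t ht x hx]
    have vgrad : ∀ x ∉ K, gradSq W (t, x) = 0 := fun x hx => by
      unfold gradSq
      exact Finset.sum_eq_zero fun i _ => by rw [vdx _ x hx, norm_zero, zero_pow two_ne_zero]
    have iMine : Integrable fun x => (1 / 2 * (dt Φ (t, x) + lap Φ (t, x)) * ‖W (t, x)‖ ^ 2 +
        4 * b * gradSq W (t, x) - 1 / 2 * ‖dt W (t, x) + lap W (t, x)‖ ^ 2) * Real.exp (g (t, x)) := by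
      refine integrable_slice_of_vanish hK ht ((((continuousOn_const.mul cΦL).mul cN).add
        (continuousOn_const.mul cgradW)).sub (continuousOn_const.mul cLW) |>.mul cexp) fun x hx => ?_
      simp only [Pi.mul_apply, Pi.add_apply, Pi.sub_apply, vW x hx, vgrad x hx, vdt x hx, vlap x hx, norm_zero,
        zero_pow two_ne_zero, mul_zero, add_zero, sub_zero, zero_mul]
    have iGen : Integrable fun x => (1 / 2 * (dt Fg (t, x) + lap Fg (t, x)) * ‖W (t, x)‖ ^ 2 +
        2 * (∑ i, ∑ j, dx (stdOrthonormalBasis ℝ E i) (dx (stdOrthonormalBasis ℝ E j) g) (t, x) *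
          ⟪dx (stdOrthonormalBasis ℝ E i) W (t, x), dx (stdOrthonormalBasis ℝ E j) W (t, x)⟫) -
        1 / 2 * ‖dt W (t, x) + lap W (t, x)‖ ^ 2) * Real.exp (g (t, x)) := by
      have cF : ContinuousOn (fun z : ℝ × E => dt Fg z + lap Fg z) (Ioo a₀ b₀ ×ˢ univ) := by
        refine (continuousOn_dtFg hg4 hFg).add ?_
        rw [show lap Fg = fun z => ∑ i, dx (stdOrthonormalBasis ℝ E i) (dx (stdOrthonormalBasis ℝ E i) Fg) z
          from rfl]
        exact continuousOn_finsetSum _ fun i _ => continuousOn_dxdxFg hg4 hFg _ _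
      have cD2 : ContinuousOn (fun z : ℝ × E => ∑ i, ∑ j, dx (stdOrthonormalBasis ℝ E i)
          (dx (stdOrthonormalBasis ℝ E j) g) z * ⟪dx (stdOrthonormalBasis ℝ E i) W z,
            dx (stdOrthonormalBasis ℝ E j) W z⟫) (Ioo a₀ b₀ ×ˢ univ) :=
        continuousOn_finsetSum _ fun i _ => continuousOn_finsetSum _ fun j _ =>
          (continuousOn_dxdxg hg4 _ _).mul ((continuousOn_dxU hW _).inner (continuousOn_dxU hW _))
      refine integrable_slice_of_vanish hK ht ((((continuousOn_const.mul cF).mul cN).add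
        (continuousOn_const.mul cD2)).sub (continuousOn_const.mul cLW) |>.mul cexp) fun x hx => ?_
      simp only [Pi.mul_apply, Pi.add_apply, Pi.sub_apply, vW x hx, vdx _ x hx, vdt x hx, vlap x hx, norm_zero,
        zero_pow two_ne_zero, mul_zero, add_zero, sub_zero, zero_mul, inner_zero_left, Finset.sum_const_zero]
    exact integral_mono iMine iGen hpt

end CylCarleman

/-! ### The axial square `⟪x,a⟫²` and axial profiles -/

section AxSq

variable {a : E} (ha : ‖a‖ = 1)

/-- The axial square is smooth. [folklore] -/
theorem contDiff_axSq {n : WithTop ℕ∞} : ContDiff ℝ n fun y : ℝ × E => ⟪y.2, a⟫ ^ 2 :=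
  (contDiff_inner_snd_const a).pow 2

/-- `D(⟪x,a⟫²)(z)v = 2⟪x,a⟫⟪v₂,a⟫`. [folklore] -/
theorem fderiv_axSq_apply (z v : ℝ × E) :
    fderiv ℝ (fun y : ℝ × E => ⟪y.2, a⟫ ^ 2) z v = 2 * ⟪z.2, a⟫ * ⟪v.2, a⟫ := by
  have hI : DifferentiableAt ℝ (fun y : ℝ × E => ⟪y.2, a⟫) z :=
    (contDiff_inner_snd_const a (n := 1)).differentiable one_ne_zero z
  rw [show (fun y : ℝ × E => ⟪y.2, a⟫ ^ 2) = fun y => (fun s : ℝ => s ^ 2) (⟪y.2, a⟫) from rfl,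
    fderiv_comp_scalar_apply (differentiableAt_pow 2) hI, fderiv_inner_snd_const]
  simp only [deriv_pow_field, Nat.cast_ofNat]
  ring

/-- `∂ₜ⟪x,a⟫² = 0`. [folklore] -/
theorem dt_axSq (z : ℝ × E) : dt (fun y : ℝ × E => ⟪y.2, a⟫ ^ 2) z = 0 := by
  rw [dt_apply, fderiv_axSq_apply]
  simp

/-- `∂ₑ⟪x,a⟫² = 2⟪x,a⟫⟪e,a⟫`. [folklore] -/
theorem dx_axSq (e : E) (z : ℝ × E) : dx e (fun y : ℝ × E => ⟪y.2, a⟫ ^ 2) z = 2 * ⟪z.2, a⟫ * ⟪e, a⟫ := by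
  rw [dx_apply, fderiv_axSq_apply]

/-- `∂ₑ∂ₑ⟪x,a⟫² = 2⟪e,a⟫²`. [folklore] -/
theorem dx_dx_axSq (e : E) (z : ℝ × E) :
    dx e (dx e fun y : ℝ × E => ⟪y.2, a⟫ ^ 2) z = 2 * ⟪e, a⟫ ^ 2 := by
  have h : dx e (fun y : ℝ × E => ⟪y.2, a⟫ ^ 2) = fun y => ⟪y.2, (2 * ⟪e, a⟫) • a⟫ := by
    funext y
    rw [dx_axSq, real_inner_smul_right]
    ring
  rw [h, dx_apply, fderiv_inner_snd_const, real_inner_smul_right]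
  ring

variable [FiniteDimensional ℝ E]

include ha in
/-- `|∇⟪x,a⟫²|² = 4⟪x,a⟫²` (unit `a`). [folklore] -/
theorem gradSq_axSq (z : ℝ × E) : gradSq (fun y : ℝ × E => ⟪y.2, a⟫ ^ 2) z = 4 * ⟪z.2, a⟫ ^ 2 := by
  unfold gradSq
  simp only [dx_axSq, Real.norm_eq_abs, sq_abs, mul_pow]
  rw [← Finset.mul_sum]
  have := (stdOrthonormalBasis ℝ E).sum_sq_inner_left a
  rw [ha, one_pow] at this
  have h2 : ∑ i, ⟪stdOrthonormalBasis ℝ E i, a⟫ ^ 2 = 1 := by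
    rw [← this]
    exact Finset.sum_congr rfl fun i _ => by rw [real_inner_comm]
  rw [h2]
  ring

include ha in
/-- `Δ⟪x,a⟫² = 2` (unit `a`). [folklore] -/
theorem lap_axSq (z : ℝ × E) : lap (fun y : ℝ × E => ⟪y.2, a⟫ ^ 2) z = 2 := by
  rw [show lap (fun y : ℝ × E => ⟪y.2, a⟫ ^ 2) z =
    ∑ i, dx (stdOrthonormalBasis ℝ E i) (dx (stdOrthonormalBasis ℝ E i) fun y : ℝ × E => ⟪y.2, a⟫ ^ 2) z from rfl]
  simp only [dx_dx_axSq]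
  rw [← Finset.mul_sum]
  have := (stdOrthonormalBasis ℝ E).sum_sq_inner_left a
  rw [ha, one_pow] at this
  have h2 : ∑ i, ⟪stdOrthonormalBasis ℝ E i, a⟫ ^ 2 = 1 := by
    rw [← this]
    exact Finset.sum_congr rfl fun i _ => by rw [real_inner_comm]
  rw [h2, mul_one]

omit [FiniteDimensional ℝ E] in
/-- Axial profiles, time derivative: `∂ₜη(⟪x,a⟫²) = 0`. [folklore] -/
theorem dt_ax {η : ℝ → ℝ} (hη : Differentiable ℝ η) (z : ℝ × E) :
    dt (fun y : ℝ × E => η (⟪y.2, a⟫ ^ 2)) z = 0 := by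
  rw [dt_comp_scalar (hη _) ((contDiff_axSq (n := 1)).differentiable one_ne_zero _), dt_axSq, mul_zero]

omit [FiniteDimensional ℝ E] in
/-- Axial profiles, spatial derivative: `∂ₑη(⟪x,a⟫²) = 2η'⟪x,a⟫⟪e,a⟫`. [folklore] -/
theorem dx_ax {η : ℝ → ℝ} (hη : Differentiable ℝ η) (e : E) (z : ℝ × E) :
    dx e (fun y : ℝ × E => η (⟪y.2, a⟫ ^ 2)) z = 2 * deriv η (⟪z.2, a⟫ ^ 2) * ⟪z.2, a⟫ * ⟪e, a⟫ := by
  rw [dx_comp_scalar (hη _) ((contDiff_axSq (n := 1)).differentiable one_ne_zero _), dx_axSq]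
  ring

include ha in
/-- Axial profiles, gradient: `|∇η(⟪x,a⟫²)|² = 4η'² ⟪x,a⟫²`. [folklore] -/
theorem gradSq_ax {η : ℝ → ℝ} (hη : Differentiable ℝ η) (z : ℝ × E) :
    gradSq (fun y : ℝ × E => η (⟪y.2, a⟫ ^ 2)) z = 4 * deriv η (⟪z.2, a⟫ ^ 2) ^ 2 * ⟪z.2, a⟫ ^ 2 := by
  rw [gradSq_comp_scalar (hη _) ((contDiff_axSq (n := 1)).differentiable one_ne_zero _), gradSq_axSq ha]
  ring

include ha in
/-- Axial profiles, Laplacian: `Δη(⟪x,a⟫²) = 4η''⟪x,a⟫² + 2η'`. [folklore] -/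
theorem lap_ax {η : ℝ → ℝ} (hη : ContDiff ℝ 2 η) (z : ℝ × E) :
    lap (fun y : ℝ × E => η (⟪y.2, a⟫ ^ 2)) z =
      4 * deriv (deriv η) (⟪z.2, a⟫ ^ 2) * ⟪z.2, a⟫ ^ 2 + 2 * deriv η (⟪z.2, a⟫ ^ 2) := by
  rw [lap_comp_scalar isOpen_univ (mem_univ z) hη contDiff_axSq.contDiffOn, gradSq_axSq ha, lap_axSq ha]
  ring

end AxSq

/-! ### The axial plateau -/

section AxialCutoff

variable (E)

/-- **The axial plateau.** There is `C ≥ 0` (absolute) such that for every unit vector `a` and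
`r₂ > 0` there is a smooth time-independent `ψ₂ = η(⟪x,a⟫²)` with `0 ≤ ψ₂ ≤ 1`, `ψ₂ = 1` on
`⟪x,a⟫² ≤ r₂²/4`, `ψ₂ = 0` on `⟪x,a⟫² ≥ (9/25)r₂²`, `∇ψ₂ = Δψ₂ = 0` off the transition layer,
and `|∇ψ₂|² ≤ C/r₂²`, `|Δψ₂| ≤ C/r₂²`. [cite: Palasek2021, §4 (proof of Prop 9: the cut-off in `|z|`)] -/
theorem exists_axial_cutoff [FiniteDimensional ℝ E] : ∃ C : ℝ, 0 ≤ C ∧ ∀ (a : E), ‖a‖ = 1 → ∀ r₂ : ℝ, 0 < r₂ →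
    ∃ ψ : ℝ × E → ℝ, ContDiff ℝ (⊤ : ℕ∞) ψ ∧ (∀ z, 0 ≤ ψ z) ∧ (∀ z, ψ z ≤ 1) ∧ (∀ z, dt ψ z = 0) ∧
      (∀ z : ℝ × E, ⟪z.2, a⟫ ^ 2 ≤ r₂ ^ 2 / 4 → ψ z = 1) ∧
      (∀ z : ℝ × E, 9 / 25 * r₂ ^ 2 ≤ ⟪z.2, a⟫ ^ 2 → ψ z = 0) ∧
      (∀ z : ℝ × E, (⟪z.2, a⟫ ^ 2 < r₂ ^ 2 / 4 ∨ 9 / 25 * r₂ ^ 2 < ⟪z.2, a⟫ ^ 2) →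
        (∀ e, dx e ψ z = 0) ∧ lap ψ z = 0) ∧
      (∀ z, gradSq ψ z ≤ C / r₂ ^ 2) ∧ (∀ z, |lap ψ z| ≤ C / r₂ ^ 2) := by
  obtain ⟨D₁, D₂, hD₁, hD₂, hstep⟩ := Carleman.exists_smooth_step
  refine ⟨132 * D₁ ^ 2 + (132 * D₂ + 20 * D₁), by positivity, fun a ha r₂ hr₂ => ?_⟩
  have hAB : r₂ ^ 2 / 4 < 9 / 25 * r₂ ^ 2 := by nlinarith
  obtain ⟨χ, hχs, hχ0, hχ1, hχnn, hχle, hχd, hχdd, hχd0, hχdd0⟩ := hstep _ _ hAB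
  have hw : 9 / 25 * r₂ ^ 2 - r₂ ^ 2 / 4 = 11 / 100 * r₂ ^ 2 := by ring
  rw [hw] at hχd hχdd
  -- the profile `η = 1 − χ`
  set η : ℝ → ℝ := fun s => 1 - χ s with hη
  have hηs : ContDiff ℝ (⊤ : ℕ∞) η := contDiff_const.sub hχs
  have hη2 : ContDiff ℝ 2 η := hηs.of_le (WithTop.coe_le_coe.2 le_top)
  have hηdiff : Differentiable ℝ η := hηs.differentiable (by simp)
  have hχdiff : Differentiable ℝ χ := hχs.differentiable (by simp)
  have hχ'diff : Differentiable ℝ (deriv χ) :=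
    ((hχs.of_le (WithTop.coe_le_coe.2 le_top) : ContDiff ℝ 2 χ).iterate_deriv' 1 1).differentiable (by simp)
  have hηd : ∀ s, deriv η s = -deriv χ s := fun s => by
    have h := (hasDerivAt_const s (1 : ℝ)).fun_sub (hχdiff s).hasDerivAt
    simp only [hη]
    rw [h.deriv]
    ring
  have hηd' : deriv η = fun s => -deriv χ s := funext hηd
  have hηdd : ∀ s, deriv (deriv η) s = -deriv (deriv χ) s := fun s => by
    rw [hηd']
    exact deriv.neg
  have hR2 : 0 < r₂ ^ 2 := by positivity
  -- uniform bounds for the profile terms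
  have hbound : ∀ s, 0 ≤ s → 4 * deriv η s ^ 2 * s ≤ 132 * D₁ ^ 2 / r₂ ^ 2 ∧
      |4 * deriv (deriv η) s * s + 2 * deriv η s| ≤ (132 * D₂ + 20 * D₁) / r₂ ^ 2 := by
    intro s hs0
    rw [hηd, hηdd]
    by_cases hs : 9 / 25 * r₂ ^ 2 < s
    · rw [hχd0 _ (Or.inr hs), hχdd0 _ (Or.inr hs)]
      constructor
      · simp only [neg_zero, ne_eq, OfNat.ofNat_ne_zero, not_false_eq_true, zero_pow, mul_zero, zero_mul]
        positivity
      · simp only [neg_zero, mul_zero, zero_mul, add_zero, abs_zero]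
        positivity
    · push Not at hs
      have b1 : |deriv χ s| ≤ D₁ / (11 / 100 * r₂ ^ 2) := hχd s
      have b2 : |deriv (deriv χ) s| ≤ D₂ / (11 / 100 * r₂ ^ 2) ^ 2 := hχdd s
      have b1' : deriv χ s ^ 2 ≤ (D₁ / (11 / 100 * r₂ ^ 2)) ^ 2 := by
        rw [← sq_abs]
        exact pow_le_pow_left₀ (abs_nonneg _) b1 2
      constructor
      · calc 4 * (-deriv χ s) ^ 2 * s ≤ 4 * (D₁ / (11 / 100 * r₂ ^ 2)) ^ 2 * (9 / 25 * r₂ ^ 2) := by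
              rw [neg_sq]
              gcongr
          _ = (4 * 10000 * 9 / (121 * 25) * D₁ ^ 2) / r₂ ^ 2 := by
              field_simp
              ring
          _ ≤ 132 * D₁ ^ 2 / r₂ ^ 2 := by
              refine div_le_div_of_nonneg_right ?_ hR2.le
              nlinarith [sq_nonneg D₁]
      · calc |4 * -deriv (deriv χ) s * s + 2 * -deriv χ s|
            ≤ |4 * -deriv (deriv χ) s * s| + |2 * -deriv χ s| := abs_add_le _ _
          _ = 4 * |deriv (deriv χ) s| * s + 2 * |deriv χ s| := by
              rw [abs_mul, abs_mul, abs_mul, abs_neg, abs_neg, abs_of_nonneg (by norm_num : (0 : ℝ) ≤ 4),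
                abs_of_nonneg hs0, abs_of_nonneg (by norm_num : (0 : ℝ) ≤ 2)]
          _ ≤ 4 * (D₂ / (11 / 100 * r₂ ^ 2) ^ 2) * (9 / 25 * r₂ ^ 2) + 2 * (D₁ / (11 / 100 * r₂ ^ 2)) := by
              gcongr
          _ = (4 * 10000 * 9 / (121 * 25) * D₂ + 200 / 11 * D₁) / r₂ ^ 2 := by
              field_simp
              ring
          _ ≤ (132 * D₂ + 20 * D₁) / r₂ ^ 2 := by
              refine div_le_div_of_nonneg_right ?_ hR2.le
              nlinarith
  -- the cut-off
  set ψ : ℝ × E → ℝ := fun y => η (⟪y.2, a⟫ ^ 2) with hψ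
  have hψs : ContDiff ℝ (⊤ : ℕ∞) ψ := hηs.comp (contDiff_axSq (E := E))
  refine ⟨ψ, hψs, fun z => ?_, fun z => ?_, fun z => dt_ax hηdiff z, fun z h1 => ?_, fun z hz => ?_,
    fun z hz => ?_, fun z => ?_, fun z => ?_⟩
  · simp only [hψ, hη]
    linarith [hχle (⟪z.2, a⟫ ^ 2)]
  · simp only [hψ, hη]
    linarith [hχnn (⟪z.2, a⟫ ^ 2)]
  · simp only [hψ, hη]
    rw [hχ0 _ h1]
    ring
  · simp only [hψ, hη]
    rw [hχ1 _ hz]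
    ring
  · have e1 : deriv η (⟪z.2, a⟫ ^ 2) = 0 := by rw [hηd, hχd0 _ hz, neg_zero]
    have e2 : deriv (deriv η) (⟪z.2, a⟫ ^ 2) = 0 := by rw [hηdd, hχdd0 _ hz, neg_zero]
    refine ⟨fun e => ?_, ?_⟩
    · rw [hψ, dx_ax hηdiff, e1]
      ring
    · rw [hψ, lap_ax ha hη2, e1, e2]
      ring
  · rw [hψ, gradSq_ax ha hηdiff]
    have := (hbound (⟪z.2, a⟫ ^ 2) (sq_nonneg _)).1
    refine this.trans (div_le_div_of_nonneg_right ?_ hR2.le)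
    have : 0 ≤ 132 * D₂ + 20 * D₁ := by positivity
    linarith
  · rw [hψ, lap_ax ha hη2]
    have := (hbound (⟪z.2, a⟫ ^ 2) (sq_nonneg _)).2
    refine this.trans (div_le_div_of_nonneg_right ?_ hR2.le)
    have : 0 ≤ 132 * D₁ ^ 2 := by positivity
    linarith

end AxialCutoff

/-! ### The annular profile in the distance to the axis -/

section RadialCutoff

variable (E)

set_option maxHeartbeats 1000000 in
/-- **The annular cut-off in the distance to the axis** (Tao's annular cut-off of Prop. 4.2,
`TaoCarlemanFirstWeight.exists_annular_cutoff`, in the variable `m = |x|² − ⟪x,a⟫²` instead of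
`|x|²`). For a unit vector `a`, `0 < r₁`, `8r₁ ≤ r₂` there is a smooth time-independent
`ψ₁ = χ(m)` with `0 ≤ ψ₁ ≤ 1`, `ψ₁ = 1` on `4r₁² ≤ m ≤ r₂²/4`, `ψ₁ = 0` on `m ≤ (36/25)r₁²` and on
`m ≥ (81/100)r₂²`, `∇ψ₁ = Δψ₁ = 0` off the two transition shells, and `|∇ψ₁|² ≤ C/r₁²`,
`|Δψ₁| ≤ C/r₁²` (`C` depending only on `E`). [cite: Palasek2021, §4 (proof of Prop 9: the cut-off in `r`)] -/
theorem exists_cylRadial_cutoff [FiniteDimensional ℝ E] : ∃ C : ℝ, 0 ≤ C ∧ ∀ (a : E), ‖a‖ = 1 →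
    ∀ (m : ℝ × E → ℝ), (m = fun y : ℝ × E => ‖y.2‖ ^ 2 - ⟪y.2, a⟫ ^ 2) → ∀ r₁ r₂ : ℝ, 0 < r₁ → 8 * r₁ ≤ r₂ →
    ∃ ψ : ℝ × E → ℝ, ContDiff ℝ (⊤ : ℕ∞) ψ ∧ (∀ z, 0 ≤ ψ z) ∧ (∀ z, ψ z ≤ 1) ∧ (∀ z, dt ψ z = 0) ∧
      (∀ z : ℝ × E, 4 * r₁ ^ 2 ≤ m z → m z ≤ r₂ ^ 2 / 4 → ψ z = 1) ∧
      (∀ z : ℝ × E, m z ≤ 36 / 25 * r₁ ^ 2 ∨ 81 / 100 * r₂ ^ 2 ≤ m z → ψ z = 0) ∧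
      (∀ z : ℝ × E, (m z < 36 / 25 * r₁ ^ 2 ∨ 81 / 100 * r₂ ^ 2 < m z ∨
          (4 * r₁ ^ 2 < m z ∧ m z < r₂ ^ 2 / 4)) → (∀ e, dx e ψ z = 0) ∧ lap ψ z = 0) ∧
      (∀ z, gradSq ψ z ≤ C / r₁ ^ 2) ∧ (∀ z, |lap ψ z| ≤ C / r₁ ^ 2) := by
  obtain ⟨D₁, D₂, hD₁, hD₂, hstep⟩ := Carleman.exists_smooth_step
  set d : ℝ := (Module.finrank ℝ E : ℝ) with hd
  have hd0 : 0 ≤ d := by positivity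
  refine ⟨11 * D₁ ^ 2 + (11 * D₂ + 4 * d * D₁) + 8 * D₁, by positivity, fun a ha m hm r₁ r₂ hr₁ hr₂ => ?_⟩
  have hm0 : ∀ z, 0 ≤ m z := fun z => cylSq_nonneg ha hm z
  have hr₂0 : 0 < r₂ := by linarith
  have hrle : r₁ ≤ r₂ := by linarith
  have hA : 36 / 25 * r₁ ^ 2 < 4 * r₁ ^ 2 := by nlinarith
  have hB : r₂ ^ 2 / 4 < 81 / 100 * r₂ ^ 2 := by nlinarith
  have hAB : 4 * r₁ ^ 2 < r₂ ^ 2 / 4 := by nlinarith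
  obtain ⟨χA, hAs, hA0, hA1, hAnn, hAle, hAd, hAdd, hAd0, hAdd0⟩ := hstep _ _ hA
  obtain ⟨χB, hBs, hB0, hB1, hBnn, hBle, hBd, hBdd, hBd0, hBdd0⟩ := hstep _ _ hB
  have hwA : 4 * r₁ ^ 2 - 36 / 25 * r₁ ^ 2 = 64 / 25 * r₁ ^ 2 := by ring
  have hwB : 81 / 100 * r₂ ^ 2 - r₂ ^ 2 / 4 = 14 / 25 * r₂ ^ 2 := by ring
  rw [hwA] at hAd hAdd
  rw [hwB] at hBd hBdd
  -- the profile
  set χ : ℝ → ℝ := fun s => χA s * (1 - χB s) with hχ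
  have hχs : ContDiff ℝ (⊤ : ℕ∞) χ := hAs.mul (contDiff_const.sub hBs)
  have hχ2 : ContDiff ℝ 2 χ := hχs.of_le (WithTop.coe_le_coe.2 le_top)
  have hχdiff : Differentiable ℝ χ := hχs.differentiable (by simp)
  have hAdiff : Differentiable ℝ χA := hAs.differentiable (by simp)
  have hBdiff : Differentiable ℝ χB := hBs.differentiable (by simp)
  have hA'diff : Differentiable ℝ (deriv χA) :=
    ((hAs.of_le (WithTop.coe_le_coe.2 le_top) : ContDiff ℝ 2 χA).iterate_deriv' 1 1).differentiable (by simp)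
  have hB'diff : Differentiable ℝ (deriv χB) :=
    ((hBs.of_le (WithTop.coe_le_coe.2 le_top) : ContDiff ℝ 2 χB).iterate_deriv' 1 1).differentiable (by simp)
  -- first and second derivative of the profile
  have hχd : ∀ s, deriv χ s = deriv χA s * (1 - χB s) - χA s * deriv χB s := fun s => by
    have h := (hAdiff s).hasDerivAt.fun_mul ((hasDerivAt_const s (1 : ℝ)).fun_sub (hBdiff s).hasDerivAt)
    simp only [hχ]
    rw [h.deriv]
    ring
  have hχd' : deriv χ = fun s => deriv χA s * (1 - χB s) - χA s * deriv χB s := funext hχd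
  have hχdd : ∀ s, deriv (deriv χ) s =
      deriv (deriv χA) s * (1 - χB s) - 2 * deriv χA s * deriv χB s - χA s * deriv (deriv χB) s := fun s => by
    rw [hχd']
    have h := ((hA'diff s).hasDerivAt.fun_mul ((hasDerivAt_const s (1 : ℝ)).fun_sub (hBdiff s).hasDerivAt)).fun_sub
      ((hAdiff s).hasDerivAt.fun_mul (hB'diff s).hasDerivAt)
    rw [h.deriv]
    ring
  -- case analysis of the profile derivatives
  have hcaseI : ∀ s, s < r₂ ^ 2 / 4 → deriv χ s = deriv χA s ∧ deriv (deriv χ) s = deriv (deriv χA) s := by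
    intro s hs
    rw [hχd, hχdd, hBd0 _ (Or.inl hs), hBdd0 _ (Or.inl hs), hB0 _ hs.le]
    constructor <;> ring
  have hcaseII : ∀ s, 4 * r₁ ^ 2 < s → deriv χ s = -deriv χB s ∧ deriv (deriv χ) s = -deriv (deriv χB) s := by
    intro s hs
    rw [hχd, hχdd, hAd0 _ (Or.inr hs), hAdd0 _ (Or.inr hs), hA1 _ hs.le]
    constructor <;> ring
  have hzero : ∀ s, (s < 36 / 25 * r₁ ^ 2 ∨ 81 / 100 * r₂ ^ 2 < s ∨ (4 * r₁ ^ 2 < s ∧ s < r₂ ^ 2 / 4)) →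
      deriv χ s = 0 ∧ deriv (deriv χ) s = 0 := by
    rintro s (hs | hs | ⟨hs1, hs2⟩)
    · obtain ⟨e1, e2⟩ := hcaseI s (by linarith)
      rw [e1, e2, hAd0 _ (Or.inl hs), hAdd0 _ (Or.inl hs)]
      exact ⟨rfl, rfl⟩
    · obtain ⟨e1, e2⟩ := hcaseII s (by linarith)
      rw [e1, e2, hBd0 _ (Or.inr hs), hBdd0 _ (Or.inr hs), neg_zero]
      exact ⟨rfl, rfl⟩
    · obtain ⟨e1, e2⟩ := hcaseI s hs2
      rw [e1, e2, hAd0 _ (Or.inr hs1), hAdd0 _ (Or.inr hs1)]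
      exact ⟨rfl, rfl⟩
  -- uniform bounds for `χ'² s` and `|χ''| s`, `|χ'|`
  have hr2 : 0 < r₁ ^ 2 := by positivity
  have hR2 : 0 < r₂ ^ 2 := by positivity
  have hinvle : (r₂ ^ 2)⁻¹ ≤ (r₁ ^ 2)⁻¹ := by
    rw [inv_le_inv₀ hR2 hr2]
    nlinarith
  have hbound : ∀ s, 0 ≤ s → 4 * deriv χ s ^ 2 * s ≤ 11 * D₁ ^ 2 / r₁ ^ 2 ∧
      |4 * deriv (deriv χ) s * s + 2 * d * deriv χ s| ≤ (11 * D₂ + 4 * d * D₁) / r₁ ^ 2 := by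
    intro s hs0
    by_cases hs : s < r₂ ^ 2 / 4
    · obtain ⟨e1, e2⟩ := hcaseI s hs
      rw [e1, e2]
      by_cases hs' : 4 * r₁ ^ 2 < s
      · rw [hAd0 _ (Or.inr hs'), hAdd0 _ (Or.inr hs')]
        constructor
        · simp only [ne_eq, OfNat.ofNat_ne_zero, not_false_eq_true, zero_pow, mul_zero, zero_mul]
          positivity
        · simp only [mul_zero, zero_mul, add_zero, abs_zero]
          positivity
      · push Not at hs'
        have b1 : |deriv χA s| ≤ D₁ / (64 / 25 * r₁ ^ 2) := hAd s
        have b2 : |deriv (deriv χA) s| ≤ D₂ / (64 / 25 * r₁ ^ 2) ^ 2 := hAdd s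
        have b1' : deriv χA s ^ 2 ≤ (D₁ / (64 / 25 * r₁ ^ 2)) ^ 2 := by
          rw [← sq_abs]
          exact pow_le_pow_left₀ (abs_nonneg _) b1 2
        constructor
        · calc 4 * deriv χA s ^ 2 * s ≤ 4 * (D₁ / (64 / 25 * r₁ ^ 2)) ^ 2 * (4 * r₁ ^ 2) := by
                gcongr
            _ = (10000 / 4096 * D₁ ^ 2) / r₁ ^ 2 := by
                field_simp
                ring
            _ ≤ 11 * D₁ ^ 2 / r₁ ^ 2 := by
                refine div_le_div_of_nonneg_right ?_ hr2.le
                nlinarith [sq_nonneg D₁]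
        · calc |4 * deriv (deriv χA) s * s + 2 * d * deriv χA s|
              ≤ |4 * deriv (deriv χA) s * s| + |2 * d * deriv χA s| := abs_add_le _ _
            _ = 4 * |deriv (deriv χA) s| * s + 2 * d * |deriv χA s| := by
                rw [abs_mul, abs_mul, abs_mul, abs_of_nonneg (by norm_num : (0 : ℝ) ≤ 4), abs_of_nonneg hs0,
                  abs_of_nonneg (by positivity : (0 : ℝ) ≤ 2 * d)]
            _ ≤ 4 * (D₂ / (64 / 25 * r₁ ^ 2) ^ 2) * (4 * r₁ ^ 2) + 2 * d * (D₁ / (64 / 25 * r₁ ^ 2)) := by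
                gcongr
            _ = (10000 / 4096 * D₂ + 50 / 64 * d * D₁) / r₁ ^ 2 := by
                field_simp
                ring
            _ ≤ (11 * D₂ + 4 * d * D₁) / r₁ ^ 2 := by
                refine div_le_div_of_nonneg_right ?_ hr2.le
                nlinarith [mul_nonneg hd0 hD₁]
    · push Not at hs
      have hsII : 4 * r₁ ^ 2 < s := lt_of_lt_of_le hAB hs
      obtain ⟨e1, e2⟩ := hcaseII s hsII
      rw [e1, e2]
      by_cases hs' : 81 / 100 * r₂ ^ 2 < s
      · rw [hBd0 _ (Or.inr hs'), hBdd0 _ (Or.inr hs')]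
        constructor
        · simp only [neg_zero, ne_eq, OfNat.ofNat_ne_zero, not_false_eq_true, zero_pow, mul_zero, zero_mul]
          positivity
        · simp only [neg_zero, mul_zero, zero_mul, add_zero, abs_zero]
          positivity
      · push Not at hs'
        have b1 : |deriv χB s| ≤ D₁ / (14 / 25 * r₂ ^ 2) := hBd s
        have b2 : |deriv (deriv χB) s| ≤ D₂ / (14 / 25 * r₂ ^ 2) ^ 2 := hBdd s
        have b1' : deriv χB s ^ 2 ≤ (D₁ / (14 / 25 * r₂ ^ 2)) ^ 2 := by
          rw [← sq_abs]
          exact pow_le_pow_left₀ (abs_nonneg _) b1 2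
        constructor
        · calc 4 * (-deriv χB s) ^ 2 * s ≤ 4 * (D₁ / (14 / 25 * r₂ ^ 2)) ^ 2 * (81 / 100 * r₂ ^ 2) := by
                rw [neg_sq]
                gcongr
            _ = (4 * 625 * 81 / (196 * 100) * D₁ ^ 2) * (r₂ ^ 2)⁻¹ := by
                field_simp
                ring
            _ ≤ (11 * D₁ ^ 2) * (r₁ ^ 2)⁻¹ := by
                refine mul_le_mul ?_ hinvle (by positivity) (by positivity)
                nlinarith [sq_nonneg D₁]
            _ = 11 * D₁ ^ 2 / r₁ ^ 2 := by rw [div_eq_mul_inv]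
        · calc |4 * -deriv (deriv χB) s * s + 2 * d * -deriv χB s|
              ≤ |4 * -deriv (deriv χB) s * s| + |2 * d * -deriv χB s| := abs_add_le _ _
            _ = 4 * |deriv (deriv χB) s| * s + 2 * d * |deriv χB s| := by
                rw [abs_mul, abs_mul, abs_mul, abs_neg, abs_neg, abs_of_nonneg (by norm_num : (0 : ℝ) ≤ 4),
                  abs_of_nonneg hs0, abs_of_nonneg (by positivity : (0 : ℝ) ≤ 2 * d)]
            _ ≤ 4 * (D₂ / (14 / 25 * r₂ ^ 2) ^ 2) * (81 / 100 * r₂ ^ 2) + 2 * d * (D₁ / (14 / 25 * r₂ ^ 2)) := by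
                gcongr
            _ = (4 * 625 * 81 / (196 * 100) * D₂ + 50 / 14 * d * D₁) * (r₂ ^ 2)⁻¹ := by
                field_simp
                ring
            _ ≤ (11 * D₂ + 4 * d * D₁) * (r₁ ^ 2)⁻¹ := by
                refine mul_le_mul ?_ hinvle (by positivity) (by positivity)
                nlinarith [mul_nonneg hd0 hD₁]
            _ = (11 * D₂ + 4 * d * D₁) / r₁ ^ 2 := by rw [div_eq_mul_inv]
  -- the cut-off
  set ψ : ℝ × E → ℝ := fun y => χ (m y) with hψ
  have hψs : ContDiff ℝ (⊤ : ℕ∞) ψ := hχs.comp (contDiff_cylSq hm)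
  have hdd : 2 * ((Module.finrank ℝ E : ℝ) - 1) = 2 * d - 2 := by rw [hd]; ring
  refine ⟨ψ, hψs, fun z => ?_, fun z => ?_, fun z => dt_cyl hm hχdiff z, fun z h1 h2 => ?_, fun z hz => ?_,
    fun z hz => ?_, fun z => ?_, fun z => ?_⟩
  · simp only [hψ, hχ]
    exact mul_nonneg (hAnn _) (by linarith [hBle (m z)])
  · simp only [hψ, hχ]
    have := hAle (m z)
    have := hBnn (m z)
    have := hAnn (m z)
    nlinarith
  · simp only [hψ, hχ]
    rw [hA1 _ h1, hB0 _ h2]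
    ring
  · simp only [hψ, hχ]
    rcases hz with hz | hz
    · rw [hA0 _ hz, zero_mul]
    · rw [hB1 _ hz]
      ring
  · obtain ⟨e1, e2⟩ := hzero _ hz
    refine ⟨fun e => ?_, ?_⟩
    · rw [hψ, dx_cyl hm hχdiff, e1]
      ring
    · rw [hψ, lap_cyl ha hm hχ2, e1, e2]
      ring
  · rw [hψ, gradSq_cyl ha hm hχdiff]
    have := (hbound (m z) (hm0 z)).1
    refine this.trans (div_le_div_of_nonneg_right ?_ hr2.le)
    have : 0 ≤ 11 * D₂ + 4 * d * D₁ + 8 * D₁ := by positivity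
    linarith
  · rw [hψ, lap_cyl ha hm hχ2, hdd]
    -- `|4χ''m + (2d − 2)χ'| ≤ |4χ''m + 2dχ'| + 2|χ'|`, and `|χ'| ≤ D₁ … ` — we simply enlarge `C`
    have hb := (hbound (m z) (hm0 z)).2
    have hgrad := (hbound (m z) (hm0 z)).1
    -- `2|χ'(m)| ≤ χ'(m)² + 1`‐type bounds are not scale invariant; instead use the profile bounds directly
    have hχ'abs : |deriv χ (m z)| ≤ 4 * D₁ / r₁ ^ 2 := by
      by_cases hs : m z < r₂ ^ 2 / 4
      · rw [(hcaseI _ hs).1]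
        calc |deriv χA (m z)| ≤ D₁ / (64 / 25 * r₁ ^ 2) := hAd _
          _ = (25 / 64 * D₁) / r₁ ^ 2 := by field_simp
          _ ≤ 4 * D₁ / r₁ ^ 2 := div_le_div_of_nonneg_right (by nlinarith) hr2.le
      · push Not at hs
        rw [(hcaseII _ (lt_of_lt_of_le hAB hs)).1, abs_neg]
        calc |deriv χB (m z)| ≤ D₁ / (14 / 25 * r₂ ^ 2) := hBd _
          _ = (25 / 14 * D₁) * (r₂ ^ 2)⁻¹ := by field_simp
          _ ≤ (4 * D₁) * (r₁ ^ 2)⁻¹ := mul_le_mul (by nlinarith) hinvle (by positivity) (by positivity)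
          _ = 4 * D₁ / r₁ ^ 2 := by rw [div_eq_mul_inv]
    calc |4 * deriv (deriv χ) (m z) * m z + (2 * d - 2) * deriv χ (m z)|
        = |(4 * deriv (deriv χ) (m z) * m z + 2 * d * deriv χ (m z)) + (-2) * deriv χ (m z)| := by ring_nf
      _ ≤ |4 * deriv (deriv χ) (m z) * m z + 2 * d * deriv χ (m z)| + |(-2) * deriv χ (m z)| := abs_add_le _ _
      _ ≤ (11 * D₂ + 4 * d * D₁) / r₁ ^ 2 + 2 * (4 * D₁ / r₁ ^ 2) := by
          rw [abs_mul, abs_neg, abs_of_nonneg (by norm_num : (0 : ℝ) ≤ 2)]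
          exact add_le_add hb (mul_le_mul_of_nonneg_left hχ'abs (by norm_num))
      _ = (11 * D₂ + 4 * d * D₁ + 8 * D₁) / r₁ ^ 2 := by ring
      _ ≤ (11 * D₁ ^ 2 + (11 * D₂ + 4 * d * D₁) + 8 * D₁) / r₁ ^ 2 := by
          refine div_le_div_of_nonneg_right ?_ hr2.le
          nlinarith [sq_nonneg D₁]

end RadialCutoff

/-! ### The cut-off of the truncated cylindrical shell -/

section CylCutoff

variable (E)

/-- **The cut-off of Prop 9** (Palasek: "a smooth spatial cutoff supported in
`{r₋ ≤ r ≤ r₊, |z| ≤ r₊}` that equals `1` in `{2r₋ ≤ r ≤ r₊/2, |z| ≤ r₊/2}` and obeys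
`|∇ʲψ(x)| ≲ r₋^{-j}` for `j = 0, 1, 2`"). There is `C ≥ 0` depending only on `E` such that for
every unit vector `a`, `0 < r₁`, `8r₁ ≤ r₂` there is a smooth time-independent `ψ` with
`0 ≤ ψ ≤ 1`, `ψ = 1` on the plateau `{4r₁² ≤ m ≤ r₂²/4, ⟪x,a⟫² ≤ r₂²/4}`, `ψ = 0` on
`{m ≤ (36/25)r₁²} ∪ {m ≥ (81/100)r₂²} ∪ {⟪x,a⟫² ≥ (9/25)r₂²}` (so strictly inside the open
truncated shell `{r₁² < m < r₂², ⟪x,a⟫² < r₂²}`), `∇ψ = Δψ = 0` off the transition layers, and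
`|∇ψ|² ≤ C/r₁²`, `|Δψ| ≤ C/r₁²` (the product of `exists_cylRadial_cutoff` and
`exists_axial_cutoff`). [cite: Palasek2021, §4 (proof of Prop 9)] -/
theorem exists_cyl_cutoff [FiniteDimensional ℝ E] : ∃ C : ℝ, 0 ≤ C ∧ ∀ (a : E), ‖a‖ = 1 →
    ∀ (m : ℝ × E → ℝ), (m = fun y : ℝ × E => ‖y.2‖ ^ 2 - ⟪y.2, a⟫ ^ 2) → ∀ r₁ r₂ : ℝ, 0 < r₁ → 8 * r₁ ≤ r₂ →
    ∃ ψ : ℝ × E → ℝ, ContDiff ℝ (⊤ : ℕ∞) ψ ∧ (∀ z, 0 ≤ ψ z) ∧ (∀ z, ψ z ≤ 1) ∧ (∀ z, dt ψ z = 0) ∧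
      (∀ z : ℝ × E, 4 * r₁ ^ 2 ≤ m z → m z ≤ r₂ ^ 2 / 4 → ⟪z.2, a⟫ ^ 2 ≤ r₂ ^ 2 / 4 → ψ z = 1) ∧
      (∀ z : ℝ × E, m z ≤ 36 / 25 * r₁ ^ 2 ∨ 81 / 100 * r₂ ^ 2 ≤ m z ∨ 9 / 25 * r₂ ^ 2 ≤ ⟪z.2, a⟫ ^ 2 → ψ z = 0) ∧
      (∀ z : ℝ × E, (m z < 36 / 25 * r₁ ^ 2 ∨ 81 / 100 * r₂ ^ 2 < m z ∨ 9 / 25 * r₂ ^ 2 < ⟪z.2, a⟫ ^ 2 ∨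
          (4 * r₁ ^ 2 < m z ∧ m z < r₂ ^ 2 / 4 ∧ ⟪z.2, a⟫ ^ 2 < r₂ ^ 2 / 4)) →
        (∀ e, dx e ψ z = 0) ∧ lap ψ z = 0) ∧
      (∀ z, gradSq ψ z ≤ C / r₁ ^ 2) ∧ (∀ z, |lap ψ z| ≤ C / r₁ ^ 2) := by
  obtain ⟨C₁, hC₁, hrad⟩ := exists_cylRadial_cutoff E
  obtain ⟨C₂, hC₂, hax⟩ := exists_axial_cutoff E
  refine ⟨2 * C₁ + 2 * C₂, by positivity, fun a ha m hm r₁ r₂ hr₁ hr₂ => ?_⟩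
  have hr₂0 : 0 < r₂ := by linarith
  obtain ⟨ψ₁, h1s, h1nn, h1le, h1t, h1pl, h1z, h1fl, h1g, h1l⟩ := hrad a ha m hm r₁ r₂ hr₁ hr₂
  obtain ⟨ψ₂, h2s, h2nn, h2le, h2t, h2pl, h2z, h2fl, h2g, h2l⟩ := hax a ha r₂ hr₂0
  have hr2 : 0 < r₁ ^ 2 := by positivity
  have hR2 : 0 < r₂ ^ 2 := by positivity
  have hinvle : (r₂ ^ 2)⁻¹ ≤ (r₁ ^ 2)⁻¹ := by
    rw [inv_le_inv₀ hR2 hr2]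
    nlinarith
  have hC₂le : C₂ / r₂ ^ 2 ≤ C₂ / r₁ ^ 2 := by
    rw [div_eq_mul_inv, div_eq_mul_inv]
    exact mul_le_mul_of_nonneg_left hinvle hC₂
  have h1d : Differentiable ℝ ψ₁ := h1s.differentiable (by simp)
  have h2d : Differentiable ℝ ψ₂ := h2s.differentiable (by simp)
  have h1c : ContDiffOn ℝ 2 ψ₁ univ := (h1s.of_le (WithTop.coe_le_coe.2 le_top)).contDiffOn
  have h2c : ContDiffOn ℝ 2 ψ₂ univ := (h2s.of_le (WithTop.coe_le_coe.2 le_top)).contDiffOn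
  set ψ : ℝ × E → ℝ := fun y => ψ₁ y * ψ₂ y with hψ
  have hdx : ∀ z e, dx e ψ z = ψ₁ z * dx e ψ₂ z + ψ₂ z * dx e ψ₁ z := fun z e => dx_mul (h1d z) (h2d z) e
  have hlap : ∀ z, lap ψ z = ψ₁ z * lap ψ₂ z + ψ₂ z * lap ψ₁ z +
      2 * ∑ i, dx (stdOrthonormalBasis ℝ E i) ψ₁ z * dx (stdOrthonormalBasis ℝ E i) ψ₂ z := fun z =>
    lap_mul isOpen_univ (mem_univ z) h1c h2c
  have hg1 : ∀ z, 0 ≤ gradSq ψ₁ z := fun z => gradSq_nonneg _ _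
  have hg2 : ∀ z, 0 ≤ gradSq ψ₂ z := fun z => gradSq_nonneg _ _
  refine ⟨ψ, h1s.mul h2s, fun z => mul_nonneg (h1nn z) (h2nn z), fun z => ?_, fun z => ?_, fun z hm1 hm2 hz => ?_,
    fun z hz => ?_, fun z hz => ?_, fun z => ?_, fun z => ?_⟩
  · calc ψ₁ z * ψ₂ z ≤ 1 * 1 := mul_le_mul (h1le z) (h2le z) (h2nn z) zero_le_one
      _ = 1 := one_mul _
  · rw [hψ, dt_mul (h1d z) (h2d z), h1t, h2t]
    ring
  · simp only [hψ]
    rw [h1pl z hm1 hm2, h2pl z hz, one_mul]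
  · simp only [hψ]
    rcases hz with hz | hz | hz
    · rw [h1z z (Or.inl hz), zero_mul]
    · rw [h1z z (Or.inr hz), zero_mul]
    · rw [h2z z hz, mul_zero]
  · -- flatness
    rcases hz with hz | hz | hz | ⟨hz1, hz2, hz3⟩
    · obtain ⟨hd1, hl1⟩ := h1fl z (Or.inl hz)
      have h0 : ψ₁ z = 0 := h1z z (Or.inl hz.le)
      refine ⟨fun e => ?_, ?_⟩
      · rw [hdx, hd1, h0]; ring
      · rw [hlap, hl1, h0, Finset.sum_eq_zero fun i _ => by rw [hd1, zero_mul]]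
        ring
    · obtain ⟨hd1, hl1⟩ := h1fl z (Or.inr (Or.inl hz))
      have h0 : ψ₁ z = 0 := h1z z (Or.inr hz.le)
      refine ⟨fun e => ?_, ?_⟩
      · rw [hdx, hd1, h0]; ring
      · rw [hlap, hl1, h0, Finset.sum_eq_zero fun i _ => by rw [hd1, zero_mul]]
        ring
    · obtain ⟨hd2, hl2⟩ := h2fl z (Or.inr hz)
      have h0 : ψ₂ z = 0 := h2z z hz.le
      refine ⟨fun e => ?_, ?_⟩
      · rw [hdx, hd2, h0]; ring
      · rw [hlap, hl2, h0, Finset.sum_eq_zero fun i _ => by rw [hd2, mul_zero]]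
        ring
    · obtain ⟨hd1, hl1⟩ := h1fl z (Or.inr (Or.inr ⟨hz1, hz2⟩))
      obtain ⟨hd2, hl2⟩ := h2fl z (Or.inl hz3)
      refine ⟨fun e => ?_, ?_⟩
      · rw [hdx, hd1, hd2]; ring
      · rw [hlap, hl1, hl2, Finset.sum_eq_zero fun i _ => by rw [hd1, zero_mul]]
        ring
  · -- gradient bound
    have h := gradSq_mul_le (h1d z) (h2d z) (E := E)
    have e1 : 2 * ψ₁ z ^ 2 * gradSq ψ₂ z ≤ 2 * 1 * (C₂ / r₁ ^ 2) := by
      have hsq : ψ₁ z ^ 2 ≤ 1 := by nlinarith [h1nn z, h1le z]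
      have := mul_le_mul hsq ((h2g z).trans hC₂le) (hg2 z) zero_le_one
      linarith
    have e2 : 2 * ψ₂ z ^ 2 * gradSq ψ₁ z ≤ 2 * 1 * (C₁ / r₁ ^ 2) := by
      have hsq : ψ₂ z ^ 2 ≤ 1 := by nlinarith [h2nn z, h2le z]
      have := mul_le_mul hsq (h1g z) (hg1 z) zero_le_one
      linarith
    calc gradSq ψ z ≤ 2 * ψ₁ z ^ 2 * gradSq ψ₂ z + 2 * ψ₂ z ^ 2 * gradSq ψ₁ z := h
      _ ≤ 2 * 1 * (C₂ / r₁ ^ 2) + 2 * 1 * (C₁ / r₁ ^ 2) := add_le_add e1 e2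
      _ = (2 * C₁ + 2 * C₂) / r₁ ^ 2 := by ring
  · -- Laplacian bound
    rw [hlap]
    have hcross := abs_sum_dx_mul_dx_le ψ₁ ψ₂ z
    have hamgm : 2 * (Real.sqrt (gradSq ψ₁ z) * Real.sqrt (gradSq ψ₂ z)) ≤ gradSq ψ₁ z + gradSq ψ₂ z := by
      nlinarith [sq_nonneg (Real.sqrt (gradSq ψ₁ z) - Real.sqrt (gradSq ψ₂ z)), Real.sq_sqrt (hg1 z),
        Real.sq_sqrt (hg2 z)]
    calc |ψ₁ z * lap ψ₂ z + ψ₂ z * lap ψ₁ z +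
          2 * ∑ i, dx (stdOrthonormalBasis ℝ E i) ψ₁ z * dx (stdOrthonormalBasis ℝ E i) ψ₂ z|
        ≤ |ψ₁ z * lap ψ₂ z| + |ψ₂ z * lap ψ₁ z| +
          |2 * ∑ i, dx (stdOrthonormalBasis ℝ E i) ψ₁ z * dx (stdOrthonormalBasis ℝ E i) ψ₂ z| := abs_add_three _ _ _
      _ ≤ C₂ / r₁ ^ 2 + C₁ / r₁ ^ 2 + (gradSq ψ₁ z + gradSq ψ₂ z) := by
          refine add_le_add (add_le_add ?_ ?_) ?_
          · rw [abs_mul, abs_of_nonneg (h1nn z)]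
            calc ψ₁ z * |lap ψ₂ z| ≤ 1 * (C₂ / r₁ ^ 2) := mul_le_mul (h1le z) ((h2l z).trans hC₂le) (abs_nonneg _) zero_le_one
              _ = _ := one_mul _
          · rw [abs_mul, abs_of_nonneg (h2nn z)]
            calc ψ₂ z * |lap ψ₁ z| ≤ 1 * (C₁ / r₁ ^ 2) := mul_le_mul (h2le z) (h1l z) (abs_nonneg _) zero_le_one
              _ = _ := one_mul _
          · rw [abs_mul, abs_of_nonneg (by norm_num : (0 : ℝ) ≤ 2)]
            exact (mul_le_mul_of_nonneg_left hcross (by norm_num)).trans hamgm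
      _ ≤ C₂ / r₁ ^ 2 + C₁ / r₁ ^ 2 + (C₁ / r₁ ^ 2 + C₂ / r₁ ^ 2) :=
          add_le_add le_rfl (add_le_add (h1g z) ((h2g z).trans hC₂le))
      _ = (2 * C₁ + 2 * C₂) / r₁ ^ 2 := by ring

end CylCutoff

end PalasekCarleman

end Literature.Analysis.FluidPDE

end
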